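import Literature.MathematicalPhysics.QuantumFieldTheory.BalabanImbrieJaffe1984to88.BIJ88NeumannRandomWalkTorus
import Literature.MathematicalPhysics.QuantumFieldTheory.BalabanImbrieJaffe1984to88.BIJ85BlockKPoincare
import Literature.MathematicalPhysics.QuantumFieldTheory.Balaban1983to89.B1TorusCubeCover

/-!
# `BalabanImbrieJaffe1984to88.BIJ88NeumannCubePartitionTorus` — T. Bałaban, *Regularity and decay of lattice Green's functions*, Commun.
Math. Phys. **89** (1983) 571–597 [Balaban1983RegularityDecay] (= [6] of [BalabanImbrieJaffe1988]), Sect. 2 ¶1 p. 575 [PDF 5]: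
**THE CUBES `□_j` AND THE PARTITION OF UNITY `{h_j}`, `Σ_j h_j² = 1`, CONSTRUCTED ON THE TORUS OF RECORD `T^{(j)}` of the abelian Higgs
model** (carrier `Balaban1983to89.Site P j`), instantiating gen 25's localization datum of `BIJ88NeumannRandomWalkTorus` for the torus
Neumann propagators `G_k(Ω,u)` BY [6]'S OWN `M`-CUBE PARTITION, discharging every combinatorial input of its (2.12)/(2.13) (the
multiplicity `2^d`, the label adjacency of degree `3^d`, the *"obvious fact"* of p. 577, `|h_j| ≤ 1`), and p. 577 *"R is a small
operator in reasonable norms because |∂^ηh_j| ≤ O(M^{−1})"* AT THE LEVEL OF THE COMMUTATOR KERNEL `K_j`.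

statement-level skeleton of published theorems with citation tags; proofs where landed; nothing here is a claim about the Yang–Mills mass gap

PDF held: `paper:balaban1983-cmp89-regularity-decay` (journal page = PDF page + 570), p. 575–578 [PDF 5–8] (text layer re-read this
session: `lit read paper:balaban1983-cmp89-regularity-decay --pages 5-8`, hits p0005 L13 *"partition of unity"*, p0007 L2 *"small
operator"*, L14 *"obvious fact"*; the displays of p. 575–576 as transcribed from the page images in gen 25's header).

CITATION HEADER (lean-in-tree rule).  Part of the lit-balaban TYPED SKELETON (HOME `run/shared/lean/pub/lit-balaban/`), PHASE-2 proof
seat p31 gen 26 (unit `lit-balaban-p31-g26`; TAKING #1 line HOME/STATUS.md 2026-08-23T23:18:14Z, free-target protocol G.5-34(d); r01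
and r18 NO OBJECTION 23:20Z/23:22Z).  WHAT IS REPRODUCED: rows **B4.Def§2** (§2 ¶1: cubes `□_j`, partition `h_j`), **B4.Eq2.2**,
**B4.Eq2.10** ((2.10)–(2.11)), **B4.Eq2.12** ((2.12)–(2.13)) of `HOME/lit-balaban-r01/ROWS-B4.md` (owner r01; heads proved on the B4
carrier — `B4PartitionUnity22.hCube` is the `ℤ^d` construction, `B4RegionCubeCarrier`, `B4Eq213ConcreteWalk`, …; THIS = the model
instance on the BIJ torus `T^{(j)}`, cells only) and the cell *"straightforward application of the random walk expansion of [6]"* of rows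
**C2.Eq2.30/C2.Eq2.31** and the `G_k(Ω,u)` half of **C2.Claim@265** of `HOME/lit-balaban-r18/ROWS-C2.md` (owner r18; heads unchanged;
this file retires the scope word *"the smooth M-cube one of [6] p.575 still not constructed"* of the v2.118 cell).  Kind: definitions with
bodies + theorems; NO `Prop`-valued fact introduced (`CubeSize` is a hypothesis package on the integer parameters, inhabited by
`CubeSize.pow`).  USED BY NAME, never restated: p35's `B1TorusCubeCover` (the same construction on the (Higgs)₂,₃ carrier — its
carrier-free one-dimensional lemmas `per3`, `per3_eval`, `per3_hprof_eq_single`, `per3_hprof_mem_Icc`, `sum_per3_hprof_sq`,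
`val_intCast_eq`, `hprof_zero_of_one_le`), r01's `B4PartitionUnity22` (`hprof` = an explicit member of the printed class, `hprof_eq_one`,
`hprof_eq_zero`, `contDiff_hprof`, `hasCompactSupport_hprof`, `D1`, `abs_sub_le_D1`), p27's `BIJ85BlockKPoincare.val_blkIter`, gen 15/25's
`nOp`, `gBox`, `IsBlockUnion`, `IsWindow`, `IsLocalization`, `aLet`, `kLet`, `bLet`, `piece`, `gZero`, `rOp`, `kLet_apply`,
`letters_mul_eq_zero_of_far`, `norm_rOp_le`, `hasSum_gZero_mul_pow`, `hasSum_piece_of_inputs`.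

THE PRINTED TEXT (verbatim, p. 575 [PDF 5]).  *"We have assumed that Ω^{(k)} is a sum of large blocks, i.e. blocks of the size M on the
unit lattice, thus Ω is a sum of the corresponding large blocks of the size M on η-lattice T_η. For each j ∈ Z^d, let us define the set
□_j = Ω ∩ {a sum of large blocks for which the point Mj is one of the vertices}. Let us observe that if the point Mj is not a boundary point
of Ω, then □_j is a cube of the size 2M and with center in Mj. For Mj lying on the boundary the set □_j is a sum of several (≦ 2^d) large
blocks. Next let us define a partition of unity {h_j}_{j∈Z^d} on T_η. For each j ∈ Z^d, we take h_j(x) = Π_{μ=1}^d h_{j_μ}(x_μ), and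
functions h_j(x), j ∈ Z, of one real variable x are defined as h_j(x) = h(x/M − j), h ∈ C₀^∞(]−⅔, ⅔[), h(x) = 1 for x ∈ [−⅓, ⅓], and it
is chosen in such a way that Σ_{j∈Z} h_j² = 1."*  p. 577 [PDF 7]: *"In the sequel we will see that R is a small operator in reasonable
norms because |∂^ηh_j| ≦ O(M^{−1}), |Δ^ηh_j| ≦ O(M^{−2}), so we have the representations G_k(Ω, A) = G₀(I − R)^{−1} = Σ_{n=0}^∞ G₀Rⁿ.
(2.12) … Let us consider a space of paths ω, each path is a sequence of points ω = {ω₀, ω₁, …, ω_n}, ω_i ∈ Z^d, satisfying the following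
condition: the points ω_i, ω_{i+1} are vertices of a unit cube of the lattice. It can be formulated also that ω_{i+1} is of the form
ω_{i+1} = ω_i + Σ_μ ε_μe_μ, where ε_μ is one of the numbers −1, 0, 1. … (2.13) and this representation follows from (2.12) and the
obvious fact that G_k(□_j)h_jK_{j′}G_k(□_{j′}) = 0 if |j − j′| = max_μ|j_μ − j′_μ| > 1."*  p. 578 [PDF 8]: *"If any of the points x, x′
belongs to supp h_j, then both belong to □_j … Of course the first situation occurs for at most 2^d cubes □_j"*; (2.19): *"Here □̃_j denotes
a cube with center Mj and size equal to 2M."*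

THE TYPING (torus of record `T^{(j)}`, `|T^{(j)}| = 2L^{m+K−j}` sites per direction; block level `k`, standing range `j + k ≤ m + K`).
* SIZES (§1): the print's large blocks are the `k`-blocks (`L^k` fine sites); the cube half-side is `M = L^k·M₀` fine sites (`half`), `M₀` =
  the print's `M` counted in large blocks; `N = |T^{(j)}|/M` cubes per direction (`nLab`), labels `i ∈ Π_μ ℤ/Nℤ` (`Lab`).  The SIZE
  HYPOTHESES `CubeSize P j k M₀` (a `Prop`-structure on the integer parameters, not a fact): `M ∣ |T^{(j)}|`, `N ≥ 2`, `M₀ ≥ 3`;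
  inhabited by `M₀ = L^q`, `j + k + q ≤ m + K`, `L^q ≥ 3` (`CubeSize.pow`).  `M₀ ≥ 3` gives `⅝M + L^k ≤ M`, so that every bond and every
  `k`-block touching `supp h_i` stays inside the window `□_i` (the torus form of the reason printed for (2.6)).
* GEOMETRY (§2): centres `Mi` (`ctr`), the coordinatewise cores `Near r i = {|x − Mi| ≤ r}` and the windows `□_i = {Mi − M ≤ x_μ < Mi + M}`
  (`InCube`, `cube` — *"a cube with center Mj and size equal to 2M"*; on the torus every cube is an interior cube; the print's
  `□_j = Ω ∩ □̃_j` for a region `Ω` is the `Ω ∩ cube i` of §5).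
* PROFILES (§4): `hT i x = Π_μ h_per(x_μ/M − i_μ)`, `h_per` = p35's three-term `N`-periodisation `per3 hprof N` of r01's profile `h`.
  RADII versus THE PRINT (r01's request, zero weight): r01's `hprof` is an explicit member of the printed class — `h = 1` on `[−⅜, ⅜] ⊇
  [−⅓, ⅓]` and `supp h ⊆ [−⅝, ⅝] ⊂ ]−⅔, ⅔[` (`B4PartitionUnity22.hprof_eq_one`/`hprof_eq_zero`), so on the torus `h_i = 1` on the core
  `{|x − Mi| ≤ ⅜M}` (⊇ the printed `⅓M`-core) and `supp h_i ⊆ {|x − Mi| ≤ ⅝M}` (inside the printed `⅔M`); the integer radii used below are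
  `⌊5M/8⌋` and `r` with `8r ≤ 3M`.

WHAT IS PROVED (0 `sorry`, standard axioms; definitions with bodies `half`, `nLab`, `Lab`, `ctr`, `Near`, `InCube`, `cube`, `hT`, `LabAdj`
and the `Prop`-structure `CubeSize`).
* §1 `half_pos`, `nLab_mul_half`, `three_pow_le_half`, `CubeSize.pos_half`, `CubeSize.two_mul_half_le` (a cube does not wrap),
  `CubeSize.pow_dvd`, **`CubeSize.pow`** (non-vacuity).
* §2 `mem_cube`, `near_mono`, `inCube_of_near`, `near_half_of_inCube`, `near_shift`, `near_unshift`, `near_of_blkIter_eq` (the `k`-block of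
  a site within `r` of `Mi` is within `r + L^k − 1`), `ctr_nonneg`, `ctr_add_half_le`, **`isBlockUnion_cube`** (*"a sum of large blocks"*:
  `□_i` is a union of `k`-blocks — gen 15's `IsBlockUnion`).
* §3 **`card_filter_inCube_le`** (*"at most 2^d cubes □_j"*: a site lies in at most `2^d` windows), `card_filter_near_le`,
  `card_filter_mem_inter_cube_le` (the multiplicity `m₀ = 2^d` of gen 25's `norm_rOp_le`/`hasSum_piece_of_inputs`).
* §4 `hT_nonneg`, `hT_le_one`, **`abs_hT_le_one`** (`|h_i| ≤ 1`), **`sum_hT_sq`** (*"Σ_j h_j² = 1"* EXACTLY at every site of `T^{(j)}`),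
  **`near_of_hT_ne_zero`** (`supp h_i ⊆ {|x − Mi| ≤ ⅝M}`), **`hT_eq_one_of_near`** (`h_i = 1` on `{|x − Mi| ≤ r}`, `8r ≤ 3M`).
* §5 **`isWindow_cube`** (`□_i` IS a window of `h_i`, gen 25's `IsWindow`: both ends of every bond touching `supp h_i` and every `k`-block
  meeting `supp h_i` lie in `□_i`) and **`isLocalization_cubes`**: `IsLocalization k Ω (fun i => Ω ∩ □_i) hT` FOR EVERY `k`-BLOCK UNION
  `Ω ⊆ T^{(j)}` — gen 25's datum INHABITED by [6]'s partition with `Q_i = Ω ∩ □_i` verbatim; hence ALL of gen 25's identities ((2.2), (2.6),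
  (2.9)–(2.12), the `K_i` kernel, the p. 265 gauge covariance) hold for it BY NAME.
* §6 `LabAdj` (*"ε_μ is one of the numbers −1, 0, 1"*: cyclic adjacency `|i − l|_∞ ≤ 1`), **`card_filter_labAdj_le`** (`≤ 3^d` neighbours),
  **`labAdj_of_near_near`** (a site within `r` of `Mi` and `r′` of `Ml`, `r + r′ < 2M` ⇒ adjacent), `hT_eq_zero_of_not_labAdj` (disjoint
  supports), `far_of_not_labAdj` (not coupled by bonds or `k`-blocks), **`letters_mul_eq_zero_of_not_labAdj`** — THE *"OBVIOUS FACT"*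
  `a_ib_l = 0 = b_ib_l` for `|i − l|_∞ > 1`, for every `U(1)` field and every family of regions `Q_i`.
* §7 `abs_per3_hprof_sub_le` (`h_per` is `3·sup|h′|`-Lipschitz), `per3_hprof_add_period` (the seam), `abs_per3_dir_sub_le` (one direction,
  cyclic distance), **`abs_hT_sub_le`**: `|h_i(x) − h_i(y)| ≤ 3·sup|h′|·|x − y|_T/M` in `Setup`'s `ℓ¹` torus distance `Site.tdist` — the torus
  form of *"|∂^ηh_j| ≦ O(M^{−1})"*; `tdist_le_of_nOp_ne_zero` (`H_Q(u)(x,y) ≠ 0 ⇒ |x − y|_T ≤ dL^k`); **`norm_kLet_apply_le`**: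
  `‖K_i(x,y)‖ ≤ (3d·sup|h′|/M₀)·‖H_{Q_i}(u)(x,y)‖` and **`norm_kLet_le`**: `‖K_i‖ ≤ (3d·sup|h′|/M₀)·‖H_{Q_i}(u)‖` (`ℓ^∞`-operator norm);
  the SUPPORT of `K_i`: `kLet_apply_eq_zero_of_not_near_left/right` (rows and columns within `⅝M + L^k` of `Mi`, deep inside `□_i`),
  `kLet_apply_eq_zero_of_near_core` (zero rows on the core `{|x − Mi| ≤ r}`, `8(r + L^k) ≤ 3M`): `K_i` lives in the annulus.
* §8 ASSEMBLY: **`norm_rOp_cubes_le`** (`‖R‖ ≤ 2^dβ` given `‖K_iG_k(Ω∩□_i,u)‖ ≤ β` — uniformly in the volume),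
  **`hasSum_gZero_mul_pow_cubes`** ((2.12) `G_k(Ω,u) = Σ_n G₀Rⁿ` given `2^dβ < 1`) and **`hasSum_piece_cubes`** ((2.13) `G_k(Ω,u) =
  Σ_ω a_{ω₀}b_{ω₁}⋯b_{ω_n}` over all walks for [6]'s own cubes, for EVERY `U(1)` field `u` and every `k`-block union `Ω`, GIVEN EXACTLY the
  two printed analytic inputs `‖G_k(Ω∩□_i,u)‖ ≤ α` (Lemma 2.1) and `‖K_iG_k(Ω∩□_i,u)‖ ≤ β` (*"≦ c₂O(1)M^{−1}"*) with `3^dβ < 1`, `2^dβ < 1` —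
  every other hypothesis of gen 25's `hasSum_piece_of_inputs` discharged by the construction).
HONEST SCOPE.  (i) No letter bound is proved: `α`, `β` stay hypotheses (Lemma 2.1 (2.15), Lemma 2.2, the `L^p` chain (2.18)–(2.22) and
the decay (2.30)/(2.31) are not touched; the commutator bound of §7 is relative to `‖H_{Q_i}(u)‖`, the printed `‖K_jG_k(□_j)h_j‖ ≤
c₂O(1)M^{−1}` needs Lemma 2.1's control of `D G` in addition).  (ii) [6]'s modified cube fields `Ã_j` and cut-offs `θ_j` are not modelled
([BalabanImbrieJaffe1988] (2.27) uses `u` itself in every `G_k(□_α,u)`; gen 25's reading).  (iii) The cube half-side is `L^kM₀` with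
`M₀ ≥ 3` dividing the torus side (`CubeSize`); the Lipschitz constant is `3·sup|h′|` (three translates; the print's `O(M^{−1})`).  (iv) The
`ℓ¹` torus distance of `Setup` is used (the print's `|·|` is `ℓ^∞`; immaterial for `O(M^{−1})`).  Imports: gen 25 `BIJ88NeumannRandomWalkTorus`,
p27 `BIJ85BlockKPoincare` (`val_blkIter`), p35 `Balaban1983to89.B1TorusCubeCover` (one-dimensional periodisation lemmas; brings r01's
`B4PartitionUnity22`).  Literature + Mathlib only.  Unit `lit-balaban-p31` (literature-prover-lit-balaban-p31-g26-0), 2026-08-23.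
NOT summit progress.
-/

open scoped BigOperators Matrix ComplexConjugate
open Finset Matrix

namespace Literature.MathematicalPhysics.QuantumFieldTheory.BalabanImbrieJaffe1984to88.BIJ88NeumannCubePartitionTorus

open Literature.MathematicalPhysics.QuantumFieldTheory.Balaban1983to89
open BIJ88Sect3Statements (U1)
open BIJ85BlockAveragesTorus BIJ85BlockAveragesTorusK
open BIJ85BlockKPoincare (val_blkIter)
open BIJ88NeumannNoZeroModesTorus BIJ88NeumannPropagator227Torus
open BIJ88NeumannRandomWalkTorus
open B4PartitionUnity22 (hprof hprof_eq_one hprof_eq_zero hprof_nonneg hprof_le_one contDiff_hprof hasCompactSupport_hprof D1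
  abs_sub_le_D1 D1_nonneg)
open B1TorusCubeCover (per3 per3_eval per3_hprof_eq_single per3_hprof_mem_Icc hprof_mul_hprof_eq_zero sum_per3_hprof_sq
  val_intCast_eq hprof_zero_of_one_le)

noncomputable section

variable {P : Params} {j : ℕ}

/-! ## §1 The cube size `M = L^k·M₀` (fine sites of `T^{(j)}`), the number of cubes per direction, the labels -/

/-- The half-side of a cube «of the size 2M» in FINE sites of `T^{(j)}`: `M = L^k·M₀` (`M₀` large blocks of `L^k` sites each; the
print's `M`, counted in unit blocks, is `M₀`). [cite: Balaban1983RegularityDecay, §2 p.575] -/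
def half (P : Params) (k M₀ : ℕ) : ℕ := P.L ^ k * M₀

/-- The number of cubes per direction on the torus `T^{(j)}`: `N = |T^{(j)}|/M` (the torus of record has equal sides
`2L^{m+K−j}`). [cite: Balaban1983RegularityDecay, §2 p.575] -/
def nLab (P : Params) (j k M₀ : ℕ) : ℕ := P.sitesPerDir j / half P k M₀

/-- The cube labels `i` («for each j ∈ Z^d»; on the torus `i ∈ Π_μ ℤ/Nℤ`). [cite: Balaban1983RegularityDecay, §2 p.575] -/
abbrev Lab (P : Params) (j k M₀ : ℕ) : Type := Fin P.d → Fin (nLab P j k M₀)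

/-- THE SIZE HYPOTHESES of the torus construction (a hypothesis package, not a fact): the cube half-side `M = L^kM₀` divides the
torus side, there are at least two cubes per direction, and a cube has at least three large blocks per half-side (`M₀ ≥ 3`, so that
`⅝M + L^k ≤ M`: the `k`-blocks and bonds touching `supp h_i` stay inside the `2M`-window).  Inhabited by `M₀ = L^q`,
`j + k + q ≤ m + K`, `q ≥ 1` (`CubeSize.pow`). [cite: Balaban1983RegularityDecay, §2 p.575] -/
structure CubeSize (P : Params) (j k M₀ : ℕ) : Prop where
  /-- `M ∣ |T^{(j)}|` -/
  dvd : half P k M₀ ∣ P.sitesPerDir j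
  /-- at least two cubes per direction -/
  two_le : 2 ≤ nLab P j k M₀
  /-- at least three large blocks per half-side -/
  three_le : 3 ≤ M₀

section Arith

variable {k M₀ : ℕ}

/-- `M ≥ 1` whenever `M₀ ≥ 1`. [cite: Balaban1983RegularityDecay, §2 p.575] -/
theorem half_pos (hM₀ : 1 ≤ M₀) : 0 < half P k M₀ := Nat.mul_pos (pow_pos P.L_pos k) hM₀

/-- `N·M = |T^{(j)}|`. [cite: Balaban1983RegularityDecay, §2 p.575] -/
theorem nLab_mul_half (hC : CubeSize P j k M₀) : nLab P j k M₀ * half P k M₀ = P.sitesPerDir j :=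
  Nat.div_mul_cancel hC.dvd

/-- `M ≥ 3L^k ≥ 3` under the size hypotheses. [cite: Balaban1983RegularityDecay, §2 p.575] -/
theorem three_pow_le_half (hC : CubeSize P j k M₀) : 3 * P.L ^ k ≤ half P k M₀ := by
  unfold half; rw [mul_comm]; exact Nat.mul_le_mul_left _ hC.three_le

/-- `L^k ≥ 1`. [folklore] -/
private theorem one_le_pow_L (P : Params) (k : ℕ) : 1 ≤ P.L ^ k := Nat.one_le_pow _ _ P.L_pos

/-- `M > 0` under the size hypotheses. [cite: Balaban1983RegularityDecay, §2 p.575] -/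
theorem CubeSize.pos_half (hC : CubeSize P j k M₀) : 0 < half P k M₀ :=
  Nat.mul_pos (pow_pos P.L_pos k) (by have := hC.three_le; omega)

/-- `2M ≤ |T^{(j)}|` (a cube does not wrap around the torus). [cite: Balaban1983RegularityDecay, §2 p.575] -/
theorem CubeSize.two_mul_half_le (hC : CubeSize P j k M₀) : 2 * half P k M₀ ≤ P.sitesPerDir j := by
  rw [← nLab_mul_half hC]; exact Nat.mul_le_mul_right _ hC.two_le

/-- `L^k ∣ |T^{(j)}|` under the size hypotheses (so the `k`-blocks do not wrap either). [cite: Balaban1983RegularityDecay, §2 p.575] -/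
theorem CubeSize.pow_dvd (hC : CubeSize P j k M₀) : P.L ^ k ∣ P.sitesPerDir j := (Dvd.intro _ rfl).trans hC.dvd

/-- NON-VACUITY: `M₀ = L^q` with `j + k + q ≤ m + K` and `L^q ≥ 3` (e.g. `q ≥ 1`, `L ≥ 3`) satisfies the size hypotheses:
`M = L^{k+q} ∣ 2L^{m+K−j}` and `N = 2L^{m+K−j−k−q} ≥ 2`. [cite: Balaban1983RegularityDecay, §2 p.575] -/
theorem CubeSize.pow {q : ℕ} (hq : j + k + q ≤ P.m + P.K) (h3 : 3 ≤ P.L ^ q) : CubeSize P j k (P.L ^ q) := by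
  have hLpos := P.L_pos
  obtain ⟨r, hr⟩ : ∃ r, P.m + P.K - j = (k + q) + r := ⟨P.m + P.K - j - k - q, by omega⟩
  have e : P.sitesPerDir j = half P k (P.L ^ q) * (2 * P.L ^ r) := by
    unfold Params.sitesPerDir half
    rw [hr, pow_add, pow_add]; ring
  have hh : 0 < half P k (P.L ^ q) := Nat.mul_pos (pow_pos hLpos k) (pow_pos hLpos q)
  refine ⟨⟨_, e⟩, ?_, h3⟩
  unfold nLab
  rw [e, Nat.mul_div_cancel_left _ hh]
  have : 1 ≤ P.L ^ r := Nat.one_le_pow _ _ hLpos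
  omega

end Arith

/-! ## §2 Centres `Mi`, the cores `{|x − Mi| ≤ r}` and the windows `□_i` (the `2M`-cubes), as sets of sites of `T^{(j)}` -/

section Geometry

variable (k M₀ : ℕ)

/-- The centre `Mi` of the cube `□_i`, coordinate `μ`, as an integer label of `T^{(j)}`. [cite: Balaban1983RegularityDecay, §2 p.575] -/
def ctr (i : Lab P j k M₀) (μ : Fin P.d) : ℤ := (half P k M₀ : ℤ) * ((i μ : ℕ) : ℤ)

/-- `Near r i x`: the torus site `x` lies within `r` of the centre `Mi` in every coordinate — `x_μ = Mi_μ + z_μ (mod |T|)` with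
`|z_μ| ≤ r` (the sets «{x : |x − Mj| ≤ ¾M}», «[−⅓M, ⅓M]»-cores etc. of p. 575). [cite: Balaban1983RegularityDecay, §2 p.575] -/
def Near (r : ℕ) (i : Lab P j k M₀) (x : Balaban1983to89.Site P j) : Prop :=
  ∀ μ, ∃ z ∈ Finset.Icc (-(r : ℤ)) r, x μ = ((ctr k M₀ i μ + z : ℤ) : ZMod (P.sitesPerDir j))

/-- `Near` is decidable (a finite search over the offsets; needed to filter the cores). [cite: Balaban1983RegularityDecay, §2 p.575] -/
instance (r : ℕ) (i : Lab P j k M₀) : DecidablePred (Near k M₀ r i) := by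
  intro x; unfold Near; infer_instance

/-- `InCube i x`: `x` lies in the window `□_i = {Mi − M ≤ x_μ < Mi + M}` («a sum of large blocks for which the point Mj is one of the
vertices»: `2M₀` large blocks per direction). [cite: Balaban1983RegularityDecay, §2 p.575] -/
def InCube (i : Lab P j k M₀) (x : Balaban1983to89.Site P j) : Prop :=
  ∀ μ, ∃ z ∈ Finset.Ico (-(half P k M₀ : ℤ)) (half P k M₀), x μ = ((ctr k M₀ i μ + z : ℤ) : ZMod (P.sitesPerDir j))

/-- `InCube` is decidable (needed to form the cube `□_i` as a `Finset`). [cite: Balaban1983RegularityDecay, §2 p.575] -/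
instance (i : Lab P j k M₀) : DecidablePred (InCube k M₀ i) := by
  intro x; unfold InCube; infer_instance

/-- The cube `□_i ⊂ T^{(j)}` («a cube of the size 2M and with center in Mj») as a finite set of sites.
[cite: Balaban1983RegularityDecay, §2 p.575] -/
def cube (i : Lab P j k M₀) : Finset (Balaban1983to89.Site P j) := Finset.univ.filter (InCube k M₀ i)

variable {k M₀}

/-- Unfolding of `cube`. [cite: Balaban1983RegularityDecay, §2 p.575] -/
theorem mem_cube {i : Lab P j k M₀} {x : Balaban1983to89.Site P j} : x ∈ cube k M₀ i ↔ InCube k M₀ i x := by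
  simp [cube]

/-- Cores grow with the radius. [cite: Balaban1983RegularityDecay, §2 p.575] -/
theorem near_mono {r r' : ℕ} (h : r ≤ r') {i : Lab P j k M₀} {x : Balaban1983to89.Site P j} (hx : Near k M₀ r i x) :
    Near k M₀ r' i x := by
  intro μ
  obtain ⟨z, hz, e⟩ := hx μ
  refine ⟨z, ?_, e⟩
  simp only [Finset.mem_Icc] at hz ⊢
  constructor <;> omega

/-- A core of radius `< M` lies in the cube window. [cite: Balaban1983RegularityDecay, §2 p.575] -/
theorem inCube_of_near {r : ℕ} (hr : r < half P k M₀) {i : Lab P j k M₀} {x : Balaban1983to89.Site P j} (hx : Near k M₀ r i x) :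
    InCube k M₀ i x := by
  intro μ
  obtain ⟨z, hz, e⟩ := hx μ
  refine ⟨z, ?_, e⟩
  simp only [Finset.mem_Icc] at hz
  simp only [Finset.mem_Ico]
  constructor <;> omega

/-- The cube window lies in the core of radius `M`. [cite: Balaban1983RegularityDecay, §2 p.575] -/
theorem near_half_of_inCube {i : Lab P j k M₀} {x : Balaban1983to89.Site P j} (hx : InCube k M₀ i x) : Near k M₀ (half P k M₀) i x := by
  intro μ
  obtain ⟨z, hz, e⟩ := hx μ
  refine ⟨z, ?_, e⟩
  simp only [Finset.mem_Ico] at hz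
  simp only [Finset.mem_Icc]
  constructor <;> omega

/-- The forward neighbour of a site within `r` of `Mi` is within `r + 1`. [cite: Balaban1983RegularityDecay, §2 p.575] -/
theorem near_shift {r : ℕ} {i : Lab P j k M₀} {x : Balaban1983to89.Site P j} (hx : Near k M₀ r i x) (ν : Fin P.d) :
    Near k M₀ (r + 1) i (x.shift ν) := by
  intro μ
  obtain ⟨z, hz, e⟩ := hx μ
  simp only [Finset.mem_Icc] at hz
  by_cases hμ : μ = ν
  · subst hμ
    refine ⟨z + 1, by simp only [Finset.mem_Icc]; constructor <;> push_cast <;> omega, ?_⟩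
    show Function.update x μ (x μ + 1) μ = _
    rw [Function.update_self, e]
    push_cast; ring
  · refine ⟨z, by simp only [Finset.mem_Icc]; constructor <;> push_cast <;> omega, ?_⟩
    show Function.update x ν (x ν + 1) μ = _
    rw [Function.update_of_ne hμ, e]

/-- The backward neighbour of a site within `r` of `Mi` is within `r + 1`. [cite: Balaban1983RegularityDecay, §2 p.575] -/
theorem near_unshift {r : ℕ} {i : Lab P j k M₀} {x : Balaban1983to89.Site P j} (hx : Near k M₀ r i x) (ν : Fin P.d) :
    Near k M₀ (r + 1) i (x.unshift ν) := by
  intro μ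
  obtain ⟨z, hz, e⟩ := hx μ
  simp only [Finset.mem_Icc] at hz
  by_cases hμ : μ = ν
  · subst hμ
    refine ⟨z - 1, by simp only [Finset.mem_Icc]; constructor <;> push_cast <;> omega, ?_⟩
    show Function.update x μ (x μ - 1) μ = _
    rw [Function.update_self, e]
    push_cast; ring
  · refine ⟨z, by simp only [Finset.mem_Icc]; constructor <;> push_cast <;> omega, ?_⟩
    show Function.update x ν (x ν - 1) μ = _
    rw [Function.update_of_ne hμ, e]

/-- If `x′.shift ν = x` then `x′ = x.unshift ν` (the translations of the torus are mutually inverse). [folklore] -/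
private theorem eq_unshift_of_shift_eq {x x' : Balaban1983to89.Site P j} {ν : Fin P.d} (h : x'.shift ν = x) : x' = x.unshift ν := by
  subst h
  funext μ
  by_cases hμ : μ = ν
  · subst hμ
    show x' μ = Function.update (Function.update x' μ (x' μ + 1)) μ (Function.update x' μ (x' μ + 1) μ - 1) μ
    rw [Function.update_self, Function.update_self]; ring
  · show x' μ = Function.update (x'.shift ν) ν _ μ
    rw [Function.update_of_ne hμ]
    show x' μ = Function.update x' ν (x' ν + 1) μ
    rw [Function.update_of_ne hμ]

/-- A site of the `k`-block of a site within `r` of `Mi` is within `r + (L^k − 1)` of `Mi` (the iterated blocks do not wrap around the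
torus: `(x_k)_μ = ⌊x_μ/L^k⌋`, standing range `j + k ≤ m + K`). [cite: BalabanImbrieJaffe1985, (5.1.2)–(5.1.3) p.313] -/
theorem near_of_blkIter_eq (hk : j + k ≤ P.m + P.K) {r : ℕ} {i : Lab P j k M₀} {x x' : Balaban1983to89.Site P j}
    (hx : Near k M₀ r i x) (h : blkIter k x' = blkIter k x) : Near k M₀ (r + (P.L ^ k - 1)) i x' := by
  intro μ
  obtain ⟨z, hz, e⟩ := hx μ
  simp only [Finset.mem_Icc] at hz
  set n : ℕ := P.L ^ k with hn_def
  have hq : (x' μ).val / n = (x μ).val / n := by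
    rw [hn_def, ← val_blkIter k hk x' μ, ← val_blkIter k hk x μ, h]
  have hn : 0 < n := by rw [hn_def]; exact pow_pos P.L_pos k
  have h1 : (x μ).val < (x μ).val / n * n + n := Nat.lt_div_mul_add hn
  have h2 : (x' μ).val < (x' μ).val / n * n + n := Nat.lt_div_mul_add hn
  have h3 : (x μ).val / n * n ≤ (x μ).val := Nat.div_mul_le_self _ _
  have h4 : (x' μ).val / n * n ≤ (x' μ).val := Nat.div_mul_le_self _ _
  rw [hq] at h2 h4
  set v : ℕ := (x μ).val with hv
  set v' : ℕ := (x' μ).val with hv'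
  set q : ℕ := v / n * n with hq_def
  refine ⟨z + ((v' : ℤ) - (v : ℤ)), ?_, ?_⟩
  · simp only [Finset.mem_Icc]
    have hn1 : 1 ≤ n := hn
    have hc : ((r + (n - 1) : ℕ) : ℤ) = (r : ℤ) + (n : ℤ) - 1 := by
      rw [Nat.cast_add, Nat.cast_sub hn1, Nat.cast_one]; ring
    rw [hc]
    constructor <;> omega
  · have ex : (((v : ℕ) : ℤ) : ZMod (P.sitesPerDir j)) = x μ := by
      rw [hv, Int.cast_natCast, ZMod.natCast_zmod_val]
    have ex' : (((v' : ℕ) : ℤ) : ZMod (P.sitesPerDir j)) = x' μ := by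
      rw [hv', Int.cast_natCast, ZMod.natCast_zmod_val]
    have : ((ctr k M₀ i μ + (z + ((v' : ℤ) - (v : ℤ))) : ℤ) : ZMod (P.sitesPerDir j))
        = ((ctr k M₀ i μ + z : ℤ) : ZMod (P.sitesPerDir j)) + (((v' : ℕ) : ℤ) : ZMod (P.sitesPerDir j))
          - (((v : ℕ) : ℤ) : ZMod (P.sitesPerDir j)) := by
      push_cast; ring
    rw [this, ← e, ex, ex']
    ring

/-- `0 ≤ Mi_μ`. [cite: Balaban1983RegularityDecay, §2 p.575] -/
theorem ctr_nonneg (i : Lab P j k M₀) (μ : Fin P.d) : 0 ≤ ctr k M₀ i μ := by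
  unfold ctr; positivity

/-- The centre label is at most `|T| − M`: `Mi_μ + M ≤ |T^{(j)}|`. [cite: Balaban1983RegularityDecay, §2 p.575] -/
theorem ctr_add_half_le (hC : CubeSize P j k M₀) (i : Lab P j k M₀) (μ : Fin P.d) :
    ctr k M₀ i μ + half P k M₀ ≤ P.sitesPerDir j := by
  unfold ctr
  have hi : (i μ : ℕ) + 1 ≤ nLab P j k M₀ := (i μ).isLt
  have e := nLab_mul_half hC
  have : (half P k M₀ : ℤ) * ((i μ : ℕ) : ℤ) + half P k M₀ = (half P k M₀ : ℤ) * (((i μ : ℕ) + 1 : ℕ) : ℤ) := by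
    push_cast; ring
  rw [this, ← e]
  push_cast
  rw [mul_comm]
  exact mul_le_mul_of_nonneg_right (by exact_mod_cast hi) (by positivity)

/-- **THE CUBES ARE UNIONS OF `k`-BLOCKS** («a sum of large blocks»): the window `□_i` is `L^k`-aligned, so it contains the whole
iterated block `B^k(x_k)` of each of its sites (standing range; gen 15's `IsBlockUnion`). [cite: Balaban1983RegularityDecay, §2 p.575] -/
theorem isBlockUnion_cube (hC : CubeSize P j k M₀) (hk : j + k ≤ P.m + P.K) (i : Lab P j k M₀) : IsBlockUnion k (cube k M₀ i) := by
  intro x hx x' hx'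
  rw [mem_cube] at hx ⊢
  rw [mem_blockK] at hx'
  intro μ
  obtain ⟨z, hz, e⟩ := hx μ
  rw [Finset.mem_Ico] at hz
  set n : ℕ := P.L ^ k with hn_def
  have hn : 0 < n := by rw [hn_def]; exact pow_pos P.L_pos k
  have hq : (x' μ).val / n = (x μ).val / n := by
    rw [hn_def, ← val_blkIter k hk x' μ, ← val_blkIter k hk x μ, hx']
  have hnz : (0 : ℤ) < n := by exact_mod_cast hn
  -- `M`, `Mi` and `|T|` are multiples of `L^k`
  have hMn : (n : ℤ) ∣ (half P k M₀ : ℤ) := ⟨M₀, by rw [hn_def]; unfold half; push_cast; ring⟩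
  have hcn : (n : ℤ) ∣ ctr k M₀ i μ := by unfold ctr; exact Dvd.dvd.mul_right hMn _
  have hSn : (n : ℤ) ∣ (P.sitesPerDir j : ℤ) := by rw [hn_def]; exact_mod_cast hC.pow_dvd
  have hc0 := ctr_nonneg (k := k) (M₀ := M₀) i μ
  have hcS := ctr_add_half_le hC i μ
  -- the representative of `x μ` is `w + m|T|`, `w = Mi + z`, `m ∈ {0, 1}`
  set w : ℤ := ctr k M₀ i μ + z with hw
  have hw0 : -(P.sitesPerDir j : ℤ) ≤ w := by
    have : ((2 * half P k M₀ : ℕ) : ℤ) ≤ P.sitesPerDir j := by exact_mod_cast hC.two_mul_half_le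
    push_cast at this
    omega
  have hw1 : w < P.sitesPerDir j := by omega
  obtain ⟨m, hm, hval⟩ := val_intCast_eq (S := P.sitesPerDir j) hw0 hw1
  have hv : (((x μ).val : ℕ) : ℤ) = w + m * P.sitesPerDir j := by rw [e]; exact hval
  -- the window edges `Mi ∓ M + m|T|` are multiples of `n`
  obtain ⟨a, ha⟩ : (n : ℤ) ∣ ctr k M₀ i μ - half P k M₀ + m * P.sitesPerDir j := (hcn.sub hMn).add (hSn.mul_left m)
  obtain ⟨a', ha'⟩ : (n : ℤ) ∣ ctr k M₀ i μ + half P k M₀ + m * P.sitesPerDir j := (hcn.add hMn).add (hSn.mul_left m)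
  -- both labels lie in the same `L^k`-window `[bn, bn + n)`, `b = x_μ / n`
  set v : ℕ := (x μ).val with hvdef
  set v' : ℕ := (x' μ).val with hv'def
  have h1 : ((v / n * n : ℕ) : ℤ) ≤ v := by exact_mod_cast Nat.div_mul_le_self v n
  have h2 : (v : ℤ) < ((v / n * n : ℕ) : ℤ) + n := by exact_mod_cast Nat.lt_div_mul_add hn
  have h3 : ((v / n * n : ℕ) : ℤ) ≤ v' := by rw [← hq]; exact_mod_cast Nat.div_mul_le_self v' n
  have h4 : (v' : ℤ) < ((v / n * n : ℕ) : ℤ) + n := by rw [← hq]; exact_mod_cast Nat.lt_div_mul_add hn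
  set b : ℤ := ((v / n : ℕ) : ℤ) with hb
  have hQ : ((v / n * n : ℕ) : ℤ) = n * b := by rw [hb]; push_cast; ring
  rw [hQ] at h1 h2 h3 h4
  -- the lower edge is `≤ bn`, the upper edge is `≥ bn + n`
  have hlo : (n : ℤ) * a ≤ n * b := by
    have hlt : (n : ℤ) * a < n * (b + 1) := by rw [mul_add, mul_one, ← ha]; linarith [hz.1]
    exact mul_le_mul_of_nonneg_left (by have := lt_of_mul_lt_mul_left hlt hnz.le; omega) hnz.le
  have hhi : (n : ℤ) * (b + 1) ≤ n * a' := by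
    have hlt : (n : ℤ) * b < n * a' := by rw [← ha']; linarith [hz.2]
    exact mul_le_mul_of_nonneg_left (by have := lt_of_mul_lt_mul_left hlt hnz.le; omega) hnz.le
  refine ⟨z + ((v' : ℤ) - (v : ℤ)), ?_, ?_⟩
  · rw [Finset.mem_Ico]
    rw [mul_add, mul_one] at hhi
    constructor
    · linarith
    · linarith
  · have ex : (((v : ℕ) : ℤ) : ZMod (P.sitesPerDir j)) = x μ := by
      rw [hvdef, Int.cast_natCast, ZMod.natCast_zmod_val]
    have ex' : (((v' : ℕ) : ℤ) : ZMod (P.sitesPerDir j)) = x' μ := by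
      rw [hv'def, Int.cast_natCast, ZMod.natCast_zmod_val]
    have : ((ctr k M₀ i μ + (z + ((v' : ℤ) - (v : ℤ))) : ℤ) : ZMod (P.sitesPerDir j))
        = ((ctr k M₀ i μ + z : ℤ) : ZMod (P.sitesPerDir j)) + (((v' : ℕ) : ℤ) : ZMod (P.sitesPerDir j))
          - (((v : ℕ) : ℤ) : ZMod (P.sitesPerDir j)) := by
      push_cast; ring
    rw [this, ← e, ex, ex']
    ring

end Geometry

/-! ## §3 Row multiplicity: a site lies in at most `2^d` cubes (cores of radius `r < M`, and the windows `□_i` themselves) -/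

section Multiplicity

/-- Two DIFFERENT labels of one direction whose windows (half-open, `z ∈ [−h, h)`) both contain the same torus label differ,
after unwinding, by EXACTLY `h`: `|z − z′| = h`. [folklore] -/
private theorem abs_sub_eq_of_two_windows {S h Nn : ℕ} (hS : S = Nn * h) (hh : 0 < h)
    {i i' : Fin Nn} {z z' : ℤ} (hz : -(h : ℤ) ≤ z ∧ z < h) (hz' : -(h : ℤ) ≤ z' ∧ z' < h)
    (e : (((h : ℤ) * (i : ℕ) + z : ℤ) : ZMod S) = (((h : ℤ) * (i' : ℕ) + z' : ℤ) : ZMod S)) (hne : i ≠ i') :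
    |z - z'| = h := by
  rw [ZMod.intCast_eq_intCast_iff_dvd_sub] at e
  obtain ⟨q, hq⟩ := e
  rw [hS] at hq
  push_cast at hq
  -- `z' − z = h·t` with `t = qN − (i' − i)`
  set t : ℤ := q * Nn - ((i' : ℕ) - (i : ℕ) : ℤ) with ht
  have hzt : z' - z = (h : ℤ) * t := by rw [ht]; linarith
  have hht : |z' - z| = (h : ℤ) * |t| := by
    rw [hzt, abs_mul, abs_of_nonneg (by positivity : (0 : ℤ) ≤ h)]
  have hlt : (h : ℤ) * |t| < (h : ℤ) * 2 := by
    rw [← hht, abs_lt]; constructor <;> omega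
  have ht2 : |t| < 2 := lt_of_mul_lt_mul_left hlt (by positivity)
  have ht0 : t ≠ 0 := by
    intro h0
    -- then `qN = i' − i`, and `|i' − i| < N` forces `i = i'`
    have hdiv : (Nn : ℤ) ∣ ((i' : ℕ) - (i : ℕ) : ℤ) := ⟨q, by rw [ht] at h0; linarith⟩
    have hsmall : (((i' : ℕ) - (i : ℕ) : ℤ)).natAbs < (Nn : ℤ).natAbs := by
      have h1 := i.isLt; have h2 := i'.isLt
      omega
    have hzero := Int.eq_zero_of_dvd_of_natAbs_lt_natAbs hdiv hsmall
    exact hne (Fin.ext (by omega))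
  have ht1 : |t| = 1 := by
    have := abs_nonneg t
    have : |t| ≠ 0 := abs_ne_zero.mpr ht0
    omega
  rw [abs_sub_comm, hht, ht1, mul_one]

/-- **At most two labels per direction**: at most two `i ∈ ℤ/Nℤ` have the torus label `v` in the window `[hi − h, hi + h)` (three
would need three integers of `[−h, h)` pairwise at distance exactly `h`). [folklore] -/
private theorem card_window_dir_le_two {S h Nn : ℕ} (hS : S = Nn * h) (hh : 0 < h) (v : ZMod S) :
    (Finset.univ.filter fun i : Fin Nn =>
        ∃ z ∈ Finset.Ico (-(h : ℤ)) h, v = (((h : ℤ) * (i : ℕ) + z : ℤ) : ZMod S)).card ≤ 2 := by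
  by_contra hc
  rw [not_le, Finset.two_lt_card] at hc
  obtain ⟨a, ha, b, hb, c, hcm, hab, hac, hbc⟩ := hc
  simp only [Finset.mem_filter, Finset.mem_univ, true_and, Finset.mem_Ico] at ha hb hcm
  obtain ⟨za, hza, ea⟩ := ha
  obtain ⟨zb, hzb, eb⟩ := hb
  obtain ⟨zc, hzc, ec⟩ := hcm
  have h1 := abs_sub_eq_of_two_windows hS hh hza hzb (ea.symm.trans eb) hab
  have h2 := abs_sub_eq_of_two_windows hS hh hza hzc (ea.symm.trans ec) hac
  have h3 := abs_sub_eq_of_two_windows hS hh hzb hzc (eb.symm.trans ec) hbc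
  have hh' : (0 : ℤ) < h := by exact_mod_cast hh
  rw [abs_eq hh'.le] at h1 h2 h3
  omega

variable {k M₀ : ℕ}

/-- **ROW MULTIPLICITY `2^d` OF THE WINDOWS**: a site of the torus lies in at most `2^d` of the cubes `□_i` (p. 575: the large blocks of a
point belong to «several (≦ 2^d)» of the sets with vertex `Mj`; [6] (5.15) *"x belongs to at most 2^d cubes"*).
[cite: Balaban1983RegularityDecay, §2 p.575] -/
theorem card_filter_inCube_le (hC : CubeSize P j k M₀) (x : Balaban1983to89.Site P j) :
    (Finset.univ.filter fun i : Lab P j k M₀ => InCube k M₀ i x).card ≤ 2 ^ P.d := by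
  classical
  set T : (μ : Fin P.d) → Finset (Fin (nLab P j k M₀)) := fun μ =>
    Finset.univ.filter fun i : Fin (nLab P j k M₀) =>
      ∃ z ∈ Finset.Ico (-(half P k M₀ : ℤ)) (half P k M₀),
        x μ = (((half P k M₀ : ℤ) * (i : ℕ) + z : ℤ) : ZMod (P.sitesPerDir j)) with hT
  have hsub : (Finset.univ.filter fun i : Lab P j k M₀ => InCube k M₀ i x) ⊆ Fintype.piFinset T := by
    intro i hi
    rw [Finset.mem_filter] at hi
    rw [Fintype.mem_piFinset]
    intro μ
    rw [hT, Finset.mem_filter]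
    exact ⟨Finset.mem_univ _, hi.2 μ⟩
  refine (Finset.card_le_card hsub).trans ?_
  rw [Fintype.card_piFinset]
  calc ∏ μ, (T μ).card ≤ ∏ _μ : Fin P.d, 2 :=
        Finset.prod_le_prod' fun μ _ => card_window_dir_le_two (nLab_mul_half hC).symm hC.pos_half (x μ)
    _ = 2 ^ P.d := by rw [Finset.prod_const, Finset.card_univ, Fintype.card_fin]

/-- **ROW MULTIPLICITY `2^d` OF THE CORES**: for `r < M` a site lies within `r` of the centres `Mi` of at most `2^d` cubes.
[cite: Balaban1983RegularityDecay, §2 p.575] -/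
theorem card_filter_near_le (hC : CubeSize P j k M₀) {r : ℕ} (hr : r < half P k M₀) (x : Balaban1983to89.Site P j) :
    (Finset.univ.filter fun i : Lab P j k M₀ => Near k M₀ r i x).card ≤ 2 ^ P.d :=
  (Finset.card_le_card fun i hi => by
      rw [Finset.mem_filter] at hi ⊢
      exact ⟨hi.1, inCube_of_near hr hi.2⟩).trans
    (card_filter_inCube_le hC x)

/-- The multiplicity in gen 25's form: every site lies in at most `2^d` of the regions `Ω ∩ □_i`. [cite: Balaban1983RegularityDecay, §2 p.575] -/
theorem card_filter_mem_inter_cube_le (hC : CubeSize P j k M₀) (Ω : Finset (Balaban1983to89.Site P j)) (x : Balaban1983to89.Site P j) :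
    (Finset.univ.filter fun i : Lab P j k M₀ => x ∈ Ω ∩ cube k M₀ i).card ≤ 2 ^ P.d :=
  (Finset.card_le_card fun i hi => by
      rw [Finset.mem_filter] at hi ⊢
      exact ⟨hi.1, mem_cube.1 (Finset.mem_inter.1 hi.2).2⟩).trans
    (card_filter_inCube_le hC x)

end Multiplicity

/-! ## §4 The periodic profiles `h_i` on `T^{(j)}`: `0 ≤ h_i ≤ 1`, `Σ_i h_i² = 1` exactly, supports and plateaus -/

section Profiles

variable (k M₀ : ℕ)

/-- **`h_i` ON THE TORUS `T^{(j)}`**: `h_i(x) = Π_μ h_per(x_μ/M − i_μ)` with the `N`-periodisation (p35's `per3`) of r01's profile `h`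
(`B4PartitionUnity22.hprof`) — the partition of unity «{h_j}_{j∈Z^d} on T_η» of p. 575 (the torus has no boundary; every cube is an
interior cube). [cite: Balaban1983RegularityDecay, (2.2) p.575] -/
def hT (i : Lab P j k M₀) (x : Balaban1983to89.Site P j) : ℝ :=
  ∏ μ, per3 hprof (nLab P j k M₀) ((((x μ).val : ℕ) : ℝ) / half P k M₀ - ((i μ : ℕ) : ℝ))

variable {k M₀}

/-- `0 ≤ h_i`. [cite: Balaban1983RegularityDecay, (2.2) p.575] -/
theorem hT_nonneg (hC : CubeSize P j k M₀) (i : Lab P j k M₀) (x : Balaban1983to89.Site P j) : 0 ≤ hT k M₀ i x :=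
  Finset.prod_nonneg fun _ _ => (per3_hprof_mem_Icc hC.two_le _).1

/-- `h_i ≤ 1`. [cite: Balaban1983RegularityDecay, (2.2) p.575] -/
theorem hT_le_one (hC : CubeSize P j k M₀) (i : Lab P j k M₀) (x : Balaban1983to89.Site P j) : hT k M₀ i x ≤ 1 :=
  Finset.prod_le_one (fun _ _ => (per3_hprof_mem_Icc hC.two_le _).1) fun _ _ => (per3_hprof_mem_Icc hC.two_le _).2

/-- `|h_i| ≤ 1` (the hypothesis `hh` of gen 25's `hasSum_piece_of_inputs`). [cite: Balaban1983RegularityDecay, (2.2) p.575] -/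
theorem abs_hT_le_one (hC : CubeSize P j k M₀) (i : Lab P j k M₀) (x : Balaban1983to89.Site P j) : |hT k M₀ i x| ≤ 1 := by
  rw [abs_of_nonneg (hT_nonneg hC i x)]
  exact hT_le_one hC i x

/-- **«Σ_j h_j² = 1» ON THE TORUS `T^{(j)}`, EXACTLY**: `Σ_{i ∈ Π_μ ℤ/Nℤ} h_i(x)² = Π_μ (Σ_{i_μ} h_per(x_μ/M − i_μ)²) = 1` at every site (p35's
one-dimensional periodic square sum `sum_per3_hprof_sq`). [cite: Balaban1983RegularityDecay, (2.2) p.575] -/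
theorem sum_hT_sq (hC : CubeSize P j k M₀) (x : Balaban1983to89.Site P j) : ∑ i : Lab P j k M₀, hT k M₀ i x ^ 2 = 1 := by
  classical
  unfold hT
  simp_rw [← Finset.prod_pow]
  rw [← Fintype.prod_sum fun μ (i : Fin (nLab P j k M₀)) =>
    per3 hprof (nLab P j k M₀) ((((x μ).val : ℕ) : ℝ) / half P k M₀ - ((i : ℕ) : ℝ)) ^ 2]
  refine Finset.prod_eq_one fun μ _ => ?_
  have hhR : (0 : ℝ) < half P k M₀ := by exact_mod_cast hC.pos_half
  refine sum_per3_hprof_sq hC.two_le (by positivity) ?_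
  rw [div_lt_iff₀ hhR]
  have h1 := ZMod.val_lt (x μ)
  have h2 := nLab_mul_half hC
  have : (x μ).val < nLab P j k M₀ * half P k M₀ := by omega
  exact_mod_cast this

/-- **SUPPORT OF `h_i`**: `h_i(x) ≠ 0 ⇒ |x − Mi| ≤ ⅝M` coordinatewise on the torus («h ∈ C₀^∞(]−⅔, ⅔[)», here r01's `tsupport h ⊆ [−⅝, ⅝]`;
integer radius `⌊5M/8⌋`). [cite: Balaban1983RegularityDecay, (2.2) p.575] -/
theorem near_of_hT_ne_zero (hC : CubeSize P j k M₀) {i : Lab P j k M₀} {x : Balaban1983to89.Site P j} (hx : hT k M₀ i x ≠ 0) :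
    Near k M₀ (5 * half P k M₀ / 8) i x := by
  intro μ
  have hh : 0 < half P k M₀ := hC.pos_half
  have hhR : (0 : ℝ) < half P k M₀ := by exact_mod_cast hh
  have hS := nLab_mul_half hC
  have hfac : per3 hprof (nLab P j k M₀) ((((x μ).val : ℕ) : ℝ) / half P k M₀ - ((i μ : ℕ) : ℝ)) ≠ 0 := by
    intro h0
    exact hx (Finset.prod_eq_zero (Finset.mem_univ μ) h0)
  obtain ⟨m, hm, hper⟩ := per3_hprof_eq_single hC.two_le ((((x μ).val : ℕ) : ℝ) / half P k M₀ - ((i μ : ℕ) : ℝ))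
  rw [hper] at hfac
  have hlt : |(((x μ).val : ℕ) : ℝ) / half P k M₀ - ((i μ : ℕ) : ℝ) - m * (nLab P j k M₀ : ℝ)| < 5 / 8 := by
    by_contra hc; exact hfac (hprof_eq_zero (not_lt.mp hc))
  -- the integer displacement
  set z : ℤ := ((x μ).val : ℤ) - ctr k M₀ i μ - m * (P.sitesPerDir j : ℤ) with hz
  have hSR : ((nLab P j k M₀ : ℕ) : ℝ) * (half P k M₀ : ℝ) = (P.sitesPerDir j : ℝ) := by exact_mod_cast hS
  have hzR : (z : ℝ) / half P k M₀
      = (((x μ).val : ℕ) : ℝ) / half P k M₀ - ((i μ : ℕ) : ℝ) - m * (nLab P j k M₀ : ℝ) := by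
    rw [hz]; unfold ctr; push_cast; rw [← hSR]; field_simp
  have habs : |(z : ℝ)| < 5 / 8 * half P k M₀ := by
    rw [← hzR, abs_div, abs_of_pos hhR, div_lt_iff₀ hhR] at hlt; exact hlt
  have h8 : 8 * |z| < 5 * (half P k M₀ : ℤ) := by
    have h1 : ((|z| : ℤ) : ℝ) = |(z : ℝ)| := Int.cast_abs
    have : (8 : ℝ) * ((|z| : ℤ) : ℝ) < 5 * ((half P k M₀ : ℕ) : ℝ) := by rw [h1]; linarith
    exact_mod_cast this
  refine ⟨z, ?_, ?_⟩
  · rw [Finset.mem_Icc, ← abs_le]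
    have hdm := Nat.div_add_mod (5 * half P k M₀) 8
    have hml := Nat.mod_lt (5 * half P k M₀) (show 0 < 8 by norm_num)
    set r : ℕ := 5 * half P k M₀ / 8 with hr
    zify at hdm hml
    omega
  · have ex : (((x μ).val : ℕ) : ZMod (P.sitesPerDir j)) = x μ := ZMod.natCast_zmod_val _
    have : ((ctr k M₀ i μ + z : ℤ) : ZMod (P.sitesPerDir j))
        = (((x μ).val : ℕ) : ℤ) - (m : ZMod (P.sitesPerDir j)) * ((P.sitesPerDir j : ℕ) : ZMod (P.sitesPerDir j)) := by
      rw [hz]; push_cast; ring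
    rw [this, ZMod.natCast_self, mul_zero, sub_zero, Int.cast_natCast, ex]

/-- **`h_i = 1` ON THE `⅜M`-CORE** (r01's `h = 1` on `[−⅜, ⅜] ⊇ [−⅓, ⅓]`, the print's «h(x) = 1 for x ∈ [−⅓, ⅓]»): if `|x − Mi| ≤ r`
coordinatewise with `8r ≤ 3M` then `h_i(x) = 1`. [cite: Balaban1983RegularityDecay, (2.2) p.575] -/
theorem hT_eq_one_of_near (hC : CubeSize P j k M₀) {r : ℕ} (hr : 8 * r ≤ 3 * half P k M₀) {i : Lab P j k M₀}
    {x : Balaban1983to89.Site P j} (hx : Near k M₀ r i x) : hT k M₀ i x = 1 := by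
  unfold hT
  refine Finset.prod_eq_one fun μ _ => ?_
  have hh : 0 < half P k M₀ := hC.pos_half
  have hhR : (0 : ℝ) < half P k M₀ := by exact_mod_cast hh
  have hS := nLab_mul_half hC
  obtain ⟨z, hz, e⟩ := hx μ
  rw [Finset.mem_Icc] at hz
  have hc := ctr_add_half_le hC i μ
  have hc0 := ctr_nonneg (k := k) (M₀ := M₀) i μ
  have hw0 : -(P.sitesPerDir j : ℤ) ≤ ctr k M₀ i μ + z := by omega
  have hw1 : ctr k M₀ i μ + z < P.sitesPerDir j := by omega
  obtain ⟨m, hm, hval⟩ := val_intCast_eq (S := P.sitesPerDir j) hw0 hw1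
  have hvalR : ((((x μ).val : ℕ)) : ℝ) = ((ctr k M₀ i μ + z : ℤ) : ℝ) + m * (P.sitesPerDir j : ℝ) := by
    have h1 : ((((x μ).val : ℕ)) : ℤ) = ctr k M₀ i μ + z + m * (P.sitesPerDir j : ℕ) := by rw [e]; exact hval
    have h2 : ((((x μ).val : ℕ)) : ℝ) = (((((x μ).val : ℕ)) : ℤ) : ℝ) := by push_cast; rfl
    rw [h2, h1]; push_cast; ring
  have harg : ((((x μ).val : ℕ)) : ℝ) / half P k M₀ - ((i μ : ℕ) : ℝ)
      = (z : ℝ) / half P k M₀ + m * (nLab P j k M₀ : ℝ) := by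
    rw [hvalR, ← hS]; unfold ctr; push_cast; field_simp; ring
  have hzr : ((|z| : ℤ) : ℝ) ≤ r := by exact_mod_cast abs_le.mpr ⟨hz.1, hz.2⟩
  have hr' : (8 : ℝ) * r ≤ 3 * half P k M₀ := by exact_mod_cast hr
  have h' : |(z : ℝ)| = ((|z| : ℤ) : ℝ) := by push_cast; rfl
  rw [harg, per3_eval hprof_zero_of_one_le hC.two_le _ (by rcases hm with rfl | rfl <;> norm_num)]
  · apply hprof_eq_one
    rw [abs_div, abs_of_pos hhR, div_le_iff₀ hhR, h']
    linarith
  · rw [abs_div, abs_of_pos hhR, div_le_iff₀ hhR, h']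
    linarith

end Profiles

/-! ## §5 The cubes are WINDOWS of the `h_i` ((2.6)) — whence gen 25's localization datum for every `k`-block union `Ω`,
with `Q_i = Ω ∩ □_i` = «□_j = Ω ∩ {a sum of large blocks for which the point Mj is one of the vertices}» -/

section Windows

variable {k M₀ : ℕ}

/-- geometry: two sites coupled by `H_Q(u)`-type locality (equal, nearest neighbours, or in one `k`-block) — the contrapositive data of
gen 25's `nOp_apply_eq_zero_of_far`. [cite: Balaban1983RegularityDecay, (2.13) p.577] -/
private theorem coupled_cases {x y : Balaban1983to89.Site P j}
    (h : ¬ ((∀ b : PBond P j, (x = b.src ∨ x = b.tgt) → ¬ (y = b.src ∨ y = b.tgt)) ∧ blkIter k x ≠ blkIter k y)) :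
    (x = y ∨ (∃ μ, y = x.shift μ) ∨ (∃ μ, x = y.shift μ)) ∨ blkIter k x = blkIter k y := by
  by_cases hB : blkIter k x = blkIter k y
  · exact Or.inr hB
  left
  by_contra hc
  push Not at hc
  obtain ⟨h1, h2, h3⟩ := hc
  apply h
  refine ⟨fun b hx hy => ?_, hB⟩
  rcases hx with rfl | rfl <;> rcases hy with h' | h'
  · exact h1 h'.symm
  · exact h2 b.dir h'
  · exact h3 b.dir (by rw [h']; rfl)
  · exact h1 h'.symm

/-- geometry: a site coupled to a site within `r` of `Mi` is within `r + L^k` of `Mi` (standing range). [cite: Balaban1983RegularityDecay, (2.6) p.576] -/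
private theorem near_of_coupled (hk : j + k ≤ P.m + P.K) {r : ℕ} {i : Lab P j k M₀} {x y : Balaban1983to89.Site P j}
    (hx : Near k M₀ r i x) (h : (x = y ∨ (∃ μ, y = x.shift μ) ∨ (∃ μ, x = y.shift μ)) ∨ blkIter k x = blkIter k y) :
    Near k M₀ (r + P.L ^ k) i y := by
  have hn := one_le_pow_L P k
  rcases h with (rfl | ⟨μ, rfl⟩ | ⟨μ, rfl⟩) | hB
  · exact near_mono (by omega) hx
  · exact near_mono (by omega) (near_shift hx μ)
  · rw [eq_unshift_of_shift_eq (rfl : y.shift μ = y.shift μ)]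
    exact near_mono (by omega) (near_unshift hx μ)
  · exact near_mono (by omega) (near_of_blkIter_eq hk hx hB.symm)

/-- **`□_i` IS A WINDOW OF `h_i`** (gen 25's `IsWindow`): both ends of every bond touching `supp h_i`, and every `k`-block meeting
`supp h_i`, lie in `□_i` — because `supp h_i ⊆ {|x − Mi| ≤ ⅝M}` and `⅝M + L^k ≤ M` (`M₀ ≥ 3`).  This is the torus form of the printed
reason for (2.6): *"the function h_j can be ≠ 0 only on the part of the boundary of □_j which is contained in the boundary of Ω"*.
[cite: Balaban1983RegularityDecay, (2.6) p.576] -/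
theorem isWindow_cube (hC : CubeSize P j k M₀) (hk : j + k ≤ P.m + P.K) (i : Lab P j k M₀) : IsWindow k (hT k M₀ i) (cube k M₀ i) where
  bond := fun b hb => by
    have h3 := three_pow_le_half hC
    have hn := one_le_pow_L P k
    rcases hb with hs | ht
    · have hs' := near_of_hT_ne_zero hC hs
      exact ⟨mem_cube.2 (inCube_of_near (by omega) hs'), mem_cube.2 (inCube_of_near (by omega) (near_shift hs' b.dir))⟩
    · have ht' := near_of_hT_ne_zero hC ht
      refine ⟨?_, mem_cube.2 (inCube_of_near (by omega) ht')⟩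
      rw [eq_unshift_of_shift_eq (rfl : b.src.shift b.dir = b.tgt)]
      exact mem_cube.2 (inCube_of_near (by omega) (near_unshift ht' b.dir))
  block := fun y hy x' hx' => by
    obtain ⟨x, hx, hx0⟩ := hy
    have h3 := three_pow_le_half hC
    have hn := one_le_pow_L P k
    have hxn := near_of_hT_ne_zero hC hx0
    have e : blkIter k x' = blkIter k x := (mem_blockK.1 hx').trans (mem_blockK.1 hx).symm
    exact mem_cube.2 (inCube_of_near (by omega) (near_of_blkIter_eq hk hxn e))

/-- **THE LOCALIZATION DATUM OF [6] FOR THE TORUS NEUMANN PROPAGATORS**: for every union `Ω` of `k`-blocks of `T^{(j)}`, the cubes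
`Q_i = Ω ∩ □_i` («□_j = Ω ∩ {a sum of large blocks for which the point Mj is one of the vertices}») and the cut-offs `h_i` form a
localization datum in gen 25's sense (`Q_i ⊆ Ω` unions of `k`-blocks carrying every bond, `k`-block and site of `Ω` that touches
`supp h_i`; `Σ_i h_i² = 1`) — so ALL identities of `BIJ88NeumannRandomWalkTorus` ((2.2), (2.6), (2.9)–(2.13), the gauge covariance)
hold for [6]'s own partition. [cite: Balaban1983RegularityDecay, (2.2) p.575, (2.6) p.576] -/
theorem isLocalization_cubes (hC : CubeSize P j k M₀) (hk : j + k ≤ P.m + P.K) {Ω : Finset (Balaban1983to89.Site P j)}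
    (hΩ : IsBlockUnion k Ω) : IsLocalization k Ω (fun i : Lab P j k M₀ => Ω ∩ cube k M₀ i) (hT k M₀) :=
  IsLocalization.of_windows hΩ (fun i => isWindow_cube hC hk i) (fun i => isBlockUnion_cube hC hk i) (sum_hT_sq hC)

end Windows

/-! ## §6 Label adjacency `|i − l|_∞ ≤ 1` (cyclic), its degree `3^d`, and the «obvious fact» of p. 577 for non-adjacent labels -/

section Adjacency

variable {k M₀ : ℕ}

/-- Cyclic nearest-neighbour adjacency of cube labels: `i_μ − l_μ ∈ {−1, 0, 1} (mod N)` in every direction (the walks of (2.13) step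
between labels with `|j − j′| = max_μ|j_μ − j′_μ| ≤ 1`). [cite: Balaban1983RegularityDecay, (2.13) p.577] -/
def LabAdj (i l : Lab P j k M₀) : Prop :=
  ∀ μ, ∃ t ∈ Finset.Icc (-1 : ℤ) 1, ((nLab P j k M₀ : ℕ) : ℤ) ∣ ((i μ : ℕ) : ℤ) - ((l μ : ℕ) : ℤ) - t

/-- `LabAdj` is decidable (needed to count the neighbours of a label). [cite: Balaban1983RegularityDecay, (2.13) p.577] -/
instance : DecidableRel (LabAdj (P := P) (j := j) (k := k) (M₀ := M₀)) := by
  intro i l; unfold LabAdj; infer_instance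

/-- **AT MOST `3^d` NEIGHBOURS** (the *"at most … (3^d)^{n−1}"* count of paths, (2.19) p. 578): every label has at most `3^d` adjacent
labels (three residues per direction). [cite: Balaban1983RegularityDecay, (2.19) p.578] -/
theorem card_filter_labAdj_le (hC : CubeSize P j k M₀) (i : Lab P j k M₀) :
    (Finset.univ.filter fun l : Lab P j k M₀ => LabAdj i l).card ≤ 3 ^ P.d := by
  classical
  haveI : NeZero (nLab P j k M₀) := ⟨by have := hC.two_le; omega⟩
  set g : Fin P.d → ℤ → Fin (nLab P j k M₀) := fun μ t =>
    ⟨(((((i μ : ℕ) : ℤ) - t : ℤ) : ZMod (nLab P j k M₀))).val, ZMod.val_lt _⟩ with hg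
  set T : (μ : Fin P.d) → Finset (Fin (nLab P j k M₀)) := fun μ => (Finset.Icc (-1 : ℤ) 1).image (g μ) with hT
  have hsub : (Finset.univ.filter fun l : Lab P j k M₀ => LabAdj i l) ⊆ Fintype.piFinset T := by
    intro l hl
    rw [Finset.mem_filter] at hl
    rw [Fintype.mem_piFinset]
    intro μ
    obtain ⟨t, ht, hdvd⟩ := hl.2 μ
    rw [hT, Finset.mem_image]
    refine ⟨t, ht, ?_⟩
    apply Fin.ext
    show (((((i μ : ℕ) : ℤ) - t : ℤ) : ZMod (nLab P j k M₀))).val = (l μ : ℕ)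
    have e : ((((i μ : ℕ) : ℤ) - t : ℤ) : ZMod (nLab P j k M₀)) = (((l μ : ℕ) : ℤ) : ZMod (nLab P j k M₀)) := by
      rw [ZMod.intCast_eq_intCast_iff_dvd_sub]
      have : (((l μ : ℕ) : ℤ)) - (((i μ : ℕ) : ℤ) - t) = -((((i μ : ℕ) : ℤ)) - (l μ : ℕ) - t) := by ring
      rw [this]; exact (dvd_neg.2 hdvd)
    rw [e, Int.cast_natCast, ZMod.val_natCast, Nat.mod_eq_of_lt (l μ).isLt]
  refine (Finset.card_le_card hsub).trans ?_
  rw [Fintype.card_piFinset]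
  calc ∏ μ, (T μ).card ≤ ∏ _μ : Fin P.d, 3 := Finset.prod_le_prod' fun μ _ => by
          rw [hT]; exact Finset.card_image_le.trans (by simp)
    _ = 3 ^ P.d := by rw [Finset.prod_const, Finset.card_univ, Fintype.card_fin]

/-- **A site near two centres forces the labels to be adjacent**: if `|y − Mi| ≤ r` and `|y − Ml| ≤ r′` coordinatewise with `r + r′ < 2M`,
then `|i − l|_∞ ≤ 1` cyclically (in each direction the two offsets differ by `M·t` with `|t| ≤ 1`). [cite: Balaban1983RegularityDecay, (2.13) p.577] -/
theorem labAdj_of_near_near (hC : CubeSize P j k M₀) {i l : Lab P j k M₀} {y : Balaban1983to89.Site P j} {r r' : ℕ}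
    (hy : Near k M₀ r i y) (hy' : Near k M₀ r' l y) (hrr : r + r' < 2 * half P k M₀) : LabAdj i l := by
  intro μ
  obtain ⟨z, hz, e⟩ := hy μ
  obtain ⟨z', hz', e'⟩ := hy' μ
  rw [Finset.mem_Icc] at hz hz'
  have hh : 0 < half P k M₀ := hC.pos_half
  have hS := nLab_mul_half hC
  have ee := e.symm.trans e'
  rw [ZMod.intCast_eq_intCast_iff_dvd_sub] at ee
  obtain ⟨q, hq⟩ := ee
  rw [← hS] at hq
  unfold ctr at hq
  push_cast at hq
  -- `z' − z = M·t` with `t = (i − l) + qN`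
  set t : ℤ := ((i μ : ℕ) : ℤ) - ((l μ : ℕ) : ℤ) + q * (nLab P j k M₀ : ℕ) with ht
  have hzt : z' - z = (half P k M₀ : ℤ) * t := by rw [ht]; linarith
  have habs : (half P k M₀ : ℤ) * |t| < (half P k M₀ : ℤ) * 2 := by
    rw [← abs_of_nonneg (by positivity : (0 : ℤ) ≤ half P k M₀), ← abs_mul, ← hzt, abs_of_nonneg (by positivity : (0 : ℤ) ≤ half P k M₀),
      abs_lt]
    constructor <;> omega
  have ht1 : |t| < 2 := lt_of_mul_lt_mul_left habs (by positivity)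
  refine ⟨t, by rw [Finset.mem_Icc, ← abs_le]; omega, ⟨-q, by rw [ht]; ring⟩⟩

/-- **NON-ADJACENT CUT-OFFS ARE DISJOINT**: `h_i(x) ≠ 0 ⇒ h_l(x) = 0` for `|i − l|_∞ > 1` (supports in the `⅝M`-cores, `⅝M + ⅝M < 2M`).
[cite: Balaban1983RegularityDecay, (2.13) p.577] -/
theorem hT_eq_zero_of_not_labAdj (hC : CubeSize P j k M₀) {i l : Lab P j k M₀} (hil : ¬ LabAdj i l) {x : Balaban1983to89.Site P j}
    (hx : hT k M₀ i x ≠ 0) : hT k M₀ l x = 0 := by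
  by_contra hl
  have hh := hC.pos_half
  exact hil (labAdj_of_near_near hC (near_of_hT_ne_zero hC hx) (near_of_hT_ne_zero hC hl) (by omega))

/-- **NON-ADJACENT CUT-OFFS ARE NOT COUPLED**: for `|i − l|_∞ > 1`, no point of `supp h_i` is an end of a bond whose other end lies in
`supp h_l`, nor in a common `k`-block with a point of `supp h_l` (`⅝M + L^k + ⅝M < 2M` for `M₀ ≥ 3`; standing range).
[cite: Balaban1983RegularityDecay, (2.13) p.577] -/
theorem far_of_not_labAdj (hC : CubeSize P j k M₀) (hk : j + k ≤ P.m + P.K) {i l : Lab P j k M₀} (hil : ¬ LabAdj i l)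
    {x y : Balaban1983to89.Site P j} (hx : hT k M₀ i x ≠ 0) (hy : hT k M₀ l y ≠ 0) :
    (∀ b : PBond P j, (x = b.src ∨ x = b.tgt) → ¬ (y = b.src ∨ y = b.tgt)) ∧ blkIter k x ≠ blkIter k y := by
  by_contra hc
  have h3 := three_pow_le_half hC
  have hn := one_le_pow_L P k
  have hyn := near_of_coupled hk (near_of_hT_ne_zero hC hx) (coupled_cases hc)
  exact hil (labAdj_of_near_near hC hyn (near_of_hT_ne_zero hC hy) (by omega))

/-- **THE «OBVIOUS FACT» OF p. 577 FOR [6]'S CUBES ON THE TORUS**: `a_ib_l = 0 = b_ib_l` whenever `|i − l|_∞ > 1` — *"G_k(□_j)h_jK_{j′}G_k(□_{j′})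
= 0 if |j − j′| = max_μ|j_μ − j′_μ| > 1"* — for EVERY `U(1)` field, every `a, c`, every family of regions `Q_i` (gen 25's
`letters_mul_eq_zero_of_far` on the support geometry above). [cite: Balaban1983RegularityDecay, (2.13) p.577] -/
theorem letters_mul_eq_zero_of_not_labAdj (hC : CubeSize P j k M₀) (hk : j + k ≤ P.m + P.K) (a c : ℝ) (U : GaugeField P j U1)
    (Q : Lab P j k M₀ → Finset (Balaban1983to89.Site P j)) {i l : Lab P j k M₀} (hil : ¬ LabAdj i l) :
    aLet a c U k Q (hT k M₀) i * bLet a c U k Q (hT k M₀) l = 0 ∧ bLet a c U k Q (hT k M₀) i * bLet a c U k Q (hT k M₀) l = 0 :=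
  letters_mul_eq_zero_of_far U (fun _ hx => hT_eq_zero_of_not_labAdj hC hil hx) fun _ _ hx hy => far_of_not_labAdj hC hk hil hx hy

end Adjacency

/-! ## §7 «|∂^ηh_j| ≤ O(M^{−1})» on the torus: the Lipschitz bound of `h_i` in the torus distance and the size and support of the
commutator kernel `K_i(x,y) = (h_i(x) − h_i(y))H_{Q_i}(u)(x,y)` -/

section Lipschitz

/-- The three-term periodisation of r01's profile is `3·sup|h′|`-Lipschitz (each translate is `sup|h′|`-Lipschitz, r01's `abs_sub_le_D1`).
[cite: Balaban1983RegularityDecay, (2.10) p.576] -/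
theorem abs_per3_hprof_sub_le (Nn : ℕ) (t s : ℝ) : |per3 hprof Nn t - per3 hprof Nn s| ≤ 3 * D1 hprof * |t - s| := by
  unfold per3
  have h1 := abs_sub_le_D1 contDiff_hprof hasCompactSupport_hprof s t
  have h2 := abs_sub_le_D1 contDiff_hprof hasCompactSupport_hprof (s - Nn) (t - Nn)
  have h3 := abs_sub_le_D1 contDiff_hprof hasCompactSupport_hprof (s + Nn) (t + Nn)
  rw [show t - Nn - (s - Nn) = t - s by ring] at h2
  rw [show t + Nn - (s + Nn) = t - s by ring] at h3
  calc |hprof t + hprof (t - Nn) + hprof (t + Nn) - (hprof s + hprof (s - Nn) + hprof (s + Nn))|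
      = |(hprof t - hprof s) + (hprof (t - Nn) - hprof (s - Nn)) + (hprof (t + Nn) - hprof (s + Nn))| := by ring_nf
    _ ≤ |hprof t - hprof s| + |hprof (t - Nn) - hprof (s - Nn)| + |hprof (t + Nn) - hprof (s + Nn)| := abs_add_three _ _ _
    _ ≤ 3 * D1 hprof * |t - s| := by linarith

/-- The seam: the three-term periodisation is `N`-periodic where it matters, `h_per(t + N) = h_per(t)` for `−N < t ≤ N − 1` (`N ≥ 2`;
the terms `h(t + 2N)`, `h(t − N)` vanish). [cite: Balaban1983RegularityDecay, (2.2) p.575] -/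
theorem per3_hprof_add_period {Nn : ℕ} (hN : 2 ≤ Nn) {t : ℝ} (h0 : -(Nn : ℝ) < t) (h1 : t ≤ Nn - 1) :
    per3 hprof Nn (t + Nn) = per3 hprof Nn t := by
  have hN' : (2 : ℝ) ≤ Nn := by exact_mod_cast hN
  unfold per3
  rw [show t + (Nn : ℝ) - Nn = t by ring,
    hprof_zero_of_one_le (t + Nn + Nn) (by rw [abs_of_nonneg (by linarith)]; linarith),
    hprof_zero_of_one_le (t - Nn) (by rw [abs_of_nonpos (by linarith)]; linarith)]
  ring

/-- for `[0,1]`-valued factors, `|Π_μ a_μ − Π_μ b_μ| ≤ Σ_μ |a_μ − b_μ|`. [folklore] -/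
private theorem abs_prod_sub_prod_le {ι : Type*} (s : Finset ι) {f g : ι → ℝ} (hf : ∀ i ∈ s, |f i| ≤ 1) (hg : ∀ i ∈ s, |g i| ≤ 1) :
    |∏ i ∈ s, f i - ∏ i ∈ s, g i| ≤ ∑ i ∈ s, |f i - g i| := by
  classical
  induction s using Finset.induction_on with
  | empty => simp
  | insert a s ha ih =>
    rw [Finset.prod_insert ha, Finset.prod_insert ha, Finset.sum_insert ha]
    have hf' : ∀ i ∈ s, |f i| ≤ 1 := fun i hi => hf i (Finset.mem_insert_of_mem hi)
    have hg' : ∀ i ∈ s, |g i| ≤ 1 := fun i hi => hg i (Finset.mem_insert_of_mem hi)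
    have hga : |g a| ≤ 1 := hg a (Finset.mem_insert_self a s)
    have hfa : |f a| ≤ 1 := hf a (Finset.mem_insert_self a s)
    have hP : |∏ i ∈ s, f i| ≤ 1 := by
      rw [Finset.abs_prod]; exact Finset.prod_le_one (fun _ _ => abs_nonneg _) hf'
    have h := ih hf' hg'
    calc |f a * ∏ i ∈ s, f i - g a * ∏ i ∈ s, g i|
        = |(f a - g a) * ∏ i ∈ s, f i + g a * (∏ i ∈ s, f i - ∏ i ∈ s, g i)| := by ring_nf
      _ ≤ |(f a - g a) * ∏ i ∈ s, f i| + |g a * (∏ i ∈ s, f i - ∏ i ∈ s, g i)| := abs_add_le _ _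
      _ = |f a - g a| * |∏ i ∈ s, f i| + |g a| * |∏ i ∈ s, f i - ∏ i ∈ s, g i| := by rw [abs_mul, abs_mul]
      _ ≤ |f a - g a| * 1 + 1 * ∑ i ∈ s, |f i - g i| :=
          add_le_add (mul_le_mul_of_nonneg_left hP (abs_nonneg _)) (mul_le_mul hga h (abs_nonneg _) zero_le_one)
      _ = |f a - g a| + ∑ i ∈ s, |f i - g i| := by ring

variable {k M₀ : ℕ}

/-- **ONE DIRECTION, SEAM-SAFE**: `|h_per(v/M − i) − h_per(w/M − i)| ≤ 3·sup|h′|·dist_T(v,w)/M` for torus labels `v, w ∈ ℤ/|T|ℤ`, with the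
cyclic distance `min((v − w) mod |T|, (w − v) mod |T|)` (across the seam one argument is shifted by the period `N`).
[cite: Balaban1983RegularityDecay, (2.10) p.576] -/
theorem abs_per3_dir_sub_le (hC : CubeSize P j k M₀) (i : Fin (nLab P j k M₀)) (v w : ZMod (P.sitesPerDir j)) :
    |per3 hprof (nLab P j k M₀) (((v.val : ℕ) : ℝ) / half P k M₀ - ((i : ℕ) : ℝ))
        - per3 hprof (nLab P j k M₀) (((w.val : ℕ) : ℝ) / half P k M₀ - ((i : ℕ) : ℝ))|
      ≤ 3 * D1 hprof * ((min (v - w).val (w - v).val : ℕ) : ℝ) / half P k M₀ := by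
  have hh : 0 < half P k M₀ := hC.pos_half
  have hhR : (0 : ℝ) < half P k M₀ := by exact_mod_cast hh
  have hS := nLab_mul_half hC
  have hN := hC.two_le
  have hD : 0 ≤ D1 hprof := D1_nonneg contDiff_hprof hasCompactSupport_hprof
  have hSR : ((nLab P j k M₀ : ℕ) : ℝ) * (half P k M₀ : ℝ) = (P.sitesPerDir j : ℝ) := by exact_mod_cast hS
  have hiN : ((i : ℕ) : ℝ) + 1 ≤ (nLab P j k M₀ : ℝ) := by exact_mod_cast i.isLt
  -- without loss of generality `v.val ≤ w.val`
  wlog hvw : v.val ≤ w.val generalizing v w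
  · have h := this w v (le_of_not_ge hvw)
    rwa [abs_sub_comm, min_comm] at h
  set aN : ℕ := v.val with haN
  set bN : ℕ := w.val with hbN
  have hb : bN < P.sitesPerDir j := ZMod.val_lt w
  have hwv : (w - v).val = bN - aN := ZMod.val_sub hvw
  set tv : ℝ := ((aN : ℕ) : ℝ) / half P k M₀ - ((i : ℕ) : ℝ) with htv
  set tw : ℝ := ((bN : ℕ) : ℝ) / half P k M₀ - ((i : ℕ) : ℝ) with htw
  -- the direct estimate with the label difference `bN − aN`
  have hdirect : |per3 hprof (nLab P j k M₀) tv - per3 hprof (nLab P j k M₀) tw|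
      ≤ 3 * D1 hprof * (((bN - aN : ℕ)) : ℝ) / half P k M₀ := by
    have h := abs_per3_hprof_sub_le (nLab P j k M₀) tv tw
    have e : |tv - tw| = (((bN - aN : ℕ)) : ℝ) / half P k M₀ := by
      rw [htv, htw, Nat.cast_sub hvw, show ((aN : ℕ) : ℝ) / half P k M₀ - ((i : ℕ) : ℝ) - (((bN : ℕ) : ℝ) / half P k M₀ - ((i : ℕ) : ℝ))
        = -((((bN : ℕ) : ℝ) - ((aN : ℕ) : ℝ)) / half P k M₀) by ring, abs_neg, abs_of_nonneg]
      exact div_nonneg (by rw [sub_nonneg]; exact_mod_cast hvw) hhR.le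
    rw [e, ← mul_div_assoc] at h; exact h
  by_cases hva : v = w
  · -- equal labels: both sides vanish
    subst hva
    have h0 : tv = tw := by rw [htv, htw, haN, hbN]
    rw [h0, sub_self, abs_zero]
    exact div_nonneg (mul_nonneg (mul_nonneg (by norm_num) hD) (Nat.cast_nonneg _)) hhR.le
  have hne : w - v ≠ 0 := sub_ne_zero.2 (Ne.symm hva)
  have hvwval : (v - w).val = P.sitesPerDir j - (bN - aN) := by
    rw [show v - w = -(w - v) by ring, ZMod.neg_val, if_neg hne, hwv]
  by_cases hcase : bN - aN ≤ P.sitesPerDir j - (bN - aN)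
  · -- no wrap: the cyclic distance is `bN − aN`
    rw [hvwval, hwv, min_eq_right hcase]
    exact hdirect
  · -- wrap: the cyclic distance is `|T| − (bN − aN)`; shift the argument of `v` by one period
    push Not at hcase
    rw [hvwval, hwv, min_eq_left hcase.le]
    -- `aN < |T|/2 ≤ M(N − 1)` so `tv ≤ N − 1`, and `tv > −N`
    have haS : 2 * aN < P.sitesPerDir j := by omega
    have htv1 : tv ≤ (nLab P j k M₀ : ℝ) - 1 := by
      rw [htv]
      have : (((aN : ℕ) : ℝ)) / half P k M₀ ≤ (nLab P j k M₀ : ℝ) - 1 := by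
        rw [div_le_iff₀ hhR]
        have h2 : 2 * ((aN : ℕ) : ℝ) < (nLab P j k M₀ : ℝ) * half P k M₀ := by rw [hSR]; exact_mod_cast haS
        have hN2 : (2 : ℝ) ≤ nLab P j k M₀ := by exact_mod_cast hN
        nlinarith
      have hi0 : (0 : ℝ) ≤ ((i : ℕ) : ℝ) := by positivity
      linarith
    have htv0 : -(nLab P j k M₀ : ℝ) < tv := by
      rw [htv]
      have ha0 : (0 : ℝ) ≤ ((aN : ℕ) : ℝ) / half P k M₀ := by positivity
      linarith
    rw [← per3_hprof_add_period hN htv0 htv1]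
    have h := abs_per3_hprof_sub_le (nLab P j k M₀) (tv + nLab P j k M₀) tw
    have e : |tv + nLab P j k M₀ - tw| = (((P.sitesPerDir j - (bN - aN) : ℕ)) : ℝ) / half P k M₀ := by
      have hle : bN - aN ≤ P.sitesPerDir j := by omega
      rw [Nat.cast_sub hle, Nat.cast_sub hvw, ← hSR, htv, htw]
      rw [show ((aN : ℕ) : ℝ) / half P k M₀ - ((i : ℕ) : ℝ) + (nLab P j k M₀ : ℝ) - (((bN : ℕ) : ℝ) / half P k M₀ - ((i : ℕ) : ℝ))
          = ((nLab P j k M₀ : ℝ) * half P k M₀ - (((bN : ℕ) : ℝ) - ((aN : ℕ) : ℝ))) / half P k M₀ by field_simp; ring]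
      rw [abs_of_nonneg]
      apply div_nonneg _ hhR.le
      have : (((bN : ℕ) : ℝ)) < (nLab P j k M₀ : ℝ) * half P k M₀ := by rw [hSR]; exact_mod_cast hb
      have : (0 : ℝ) ≤ ((aN : ℕ) : ℝ) := by positivity
      linarith
    rw [e, ← mul_div_assoc] at h
    exact h

/-- **«|∂^ηh_j| ≤ O(M^{−1})» ON THE TORUS, IN THE TORUS DISTANCE**: `|h_i(x) − h_i(y)| ≤ 3·sup|h′|·|x − y|_T/M` for ALL sites `x, y` of
`T^{(j)}`, with `Setup`'s `ℓ¹` torus distance `Site.tdist` (lattice units of `T^{(j)}`) and `M = L^kM₀` — r01's mean-value bound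
`abs_sub_le_D1` per direction, the factors bounded by `1`. [cite: Balaban1983RegularityDecay, (2.10) p.576] -/
theorem abs_hT_sub_le (hC : CubeSize P j k M₀) (i : Lab P j k M₀) (x y : Balaban1983to89.Site P j) :
    |hT k M₀ i x - hT k M₀ i y| ≤ 3 * D1 hprof * (Balaban1983to89.Site.tdist x y : ℝ) / half P k M₀ := by
  unfold hT Balaban1983to89.Site.tdist
  have hN := hC.two_le
  refine (abs_prod_sub_prod_le _ (fun μ _ => ?_) (fun μ _ => ?_)).trans ?_
  · rw [abs_of_nonneg (per3_hprof_mem_Icc hN _).1]; exact (per3_hprof_mem_Icc hN _).2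
  · rw [abs_of_nonneg (per3_hprof_mem_Icc hN _).1]; exact (per3_hprof_mem_Icc hN _).2
  · rw [Nat.cast_sum, Finset.mul_sum, Finset.sum_div]
    exact Finset.sum_le_sum fun μ _ => abs_per3_dir_sub_le hC (i μ) (x μ) (y μ)

/-- torus geometry: the `ℓ¹` torus distance of the two ends of a bond is at most `1`. [folklore] -/
private theorem tdist_shift_le (x : Balaban1983to89.Site P j) (μ : Fin P.d) : Balaban1983to89.Site.tdist x (x.shift μ) ≤ 1 := by
  unfold Balaban1983to89.Site.tdist
  rw [Finset.sum_eq_single μ]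
  · have e : (x.shift μ) μ = x μ + 1 := by show Function.update x μ (x μ + 1) μ = _; rw [Function.update_self]
    rw [e, show x μ + 1 - x μ = 1 by ring]
    refine (min_le_right _ _).trans ?_
    rw [ZMod.val_one_eq_one_mod]
    exact (Nat.mod_le 1 _)
  · intro ν _ hν
    have e : (x.shift μ) ν = x ν := by show Function.update x μ (x μ + 1) ν = _; rw [Function.update_of_ne hν]
    rw [e, sub_self, ZMod.val_zero, Nat.zero_min]
  · intro h; exact absurd (Finset.mem_univ μ) h

/-- torus geometry: `tdist` is symmetric. [folklore] -/
private theorem tdist_comm (x y : Balaban1983to89.Site P j) : Balaban1983to89.Site.tdist x y = Balaban1983to89.Site.tdist y x := by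
  unfold Balaban1983to89.Site.tdist
  exact Finset.sum_congr rfl fun μ _ => min_comm _ _

/-- torus geometry: `tdist x x = 0`. [folklore] -/
private theorem tdist_self (x : Balaban1983to89.Site P j) : Balaban1983to89.Site.tdist x x = 0 := by
  unfold Balaban1983to89.Site.tdist
  exact Finset.sum_eq_zero fun μ _ => by rw [sub_self, ZMod.val_zero, Nat.zero_min]

/-- torus geometry: two sites of one `k`-block are at `ℓ¹` distance `≤ d(L^k − 1)` (standing range: the blocks do not wrap).
[cite: BalabanImbrieJaffe1985, (5.1.2)–(5.1.3) p.313] -/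
private theorem tdist_le_of_blkIter_eq (hk : j + k ≤ P.m + P.K) {x y : Balaban1983to89.Site P j} (h : blkIter k x = blkIter k y) :
    Balaban1983to89.Site.tdist x y ≤ P.d * (P.L ^ k - 1) := by
  unfold Balaban1983to89.Site.tdist
  have hn : 0 < P.L ^ k := pow_pos P.L_pos k
  have key : ∀ μ, min (x μ - y μ).val (y μ - x μ).val ≤ P.L ^ k - 1 := by
    intro μ
    have hq : (x μ).val / P.L ^ k = (y μ).val / P.L ^ k := by
      rw [← val_blkIter k hk x μ, ← val_blkIter k hk y μ, h]
    have h1 := Nat.div_mul_le_self (x μ).val (P.L ^ k)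
    have h2 : (x μ).val < (x μ).val / P.L ^ k * P.L ^ k + P.L ^ k := Nat.lt_div_mul_add hn
    have h3 := Nat.div_mul_le_self (y μ).val (P.L ^ k)
    have h4 : (y μ).val < (y μ).val / P.L ^ k * P.L ^ k + P.L ^ k := Nat.lt_div_mul_add hn
    rw [hq] at h1 h2
    set q := (y μ).val / P.L ^ k * P.L ^ k
    by_cases hle : (y μ).val ≤ (x μ).val
    · exact (min_le_left _ _).trans (by rw [ZMod.val_sub hle]; omega)
    · exact (min_le_right _ _).trans (by rw [ZMod.val_sub (by omega)]; omega)
  calc ∑ μ, min (x μ - y μ).val (y μ - x μ).val ≤ ∑ _μ : Fin P.d, (P.L ^ k - 1) := Finset.sum_le_sum fun μ _ => key μ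
    _ = P.d * (P.L ^ k - 1) := by rw [Finset.sum_const, Finset.card_univ, Fintype.card_fin, smul_eq_mul]

/-- **COUPLED SITES ARE `O(L^k)`-CLOSE**: if `H_Q(u)(x,y) ≠ 0` then `|x − y|_T ≤ dL^k` (`x`, `y` are the ends of one bond or lie in one
`k`-block; gen 25's `nOp_apply_eq_zero_of_far`). [cite: Balaban1983RegularityDecay, (2.13) p.577] -/
theorem tdist_le_of_nOp_ne_zero (hk : j + k ≤ P.m + P.K) (a c : ℝ) (U : GaugeField P j U1) (Q' : Finset (Balaban1983to89.Site P j))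
    {x y : Balaban1983to89.Site P j} (h : nOp a c U k Q' x y ≠ 0) : Balaban1983to89.Site.tdist x y ≤ P.d * P.L ^ k := by
  have hd : 1 ≤ P.d := P.hd
  have hn := one_le_pow_L P k
  have hdn : 1 ≤ P.d * P.L ^ k := Nat.mul_pos hd hn
  have hc : ¬ ((∀ b : PBond P j, (x = b.src ∨ x = b.tgt) → ¬ (y = b.src ∨ y = b.tgt)) ∧ blkIter k x ≠ blkIter k y) :=
    fun hc => h (nOp_apply_eq_zero_of_far a c U k Q' hc.1 hc.2)
  rcases coupled_cases hc with (rfl | ⟨μ, rfl⟩ | ⟨μ, rfl⟩) | hB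
  · rw [tdist_self]; exact Nat.zero_le _
  · exact (tdist_shift_le x μ).trans hdn
  · rw [tdist_comm]; exact (tdist_shift_le y μ).trans hdn
  · exact (tdist_le_of_blkIter_eq hk hB).trans (Nat.mul_le_mul_left _ (Nat.sub_le _ _))

/-- **THE COMMUTATOR KERNEL IS `O(M^{−1})` TIMES THE NEUMANN OPERATOR KERNEL, ENTRYWISE**: for every family of regions `Q_i`, every `U(1)`
field, every `a, c`:  `‖K_i(x,y)‖ ≤ (3d·sup|h′|/M₀)·‖H_{Q_i}(u)(x,y)‖` — gen 25's `K_i(x,y) = (h_i(x) − h_i(y))H_{Q_i}(x,y)`, the torus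
Lipschitz bound and `|x − y|_T ≤ dL^k` on the support of `H_{Q_i}` (*"R is a small operator in reasonable norms because |∂^ηh_j| ≤
O(M^{−1})"*, at the level of `K_j`). [cite: Balaban1983RegularityDecay, (2.10)–(2.12) pp.576–577] -/
theorem norm_kLet_apply_le (hC : CubeSize P j k M₀) (hk : j + k ≤ P.m + P.K) (a c : ℝ) (U : GaugeField P j U1)
    (Q : Lab P j k M₀ → Finset (Balaban1983to89.Site P j)) (i : Lab P j k M₀) (x y : Balaban1983to89.Site P j) :
    ‖kLet a c U k Q (hT k M₀) i x y‖ ≤ 3 * P.d * D1 hprof / M₀ * ‖nOp a c U k (Q i) x y‖ := by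
  have hD : 0 ≤ D1 hprof := D1_nonneg contDiff_hprof hasCompactSupport_hprof
  have hM₀ : (0 : ℝ) < M₀ := by have := hC.three_le; exact_mod_cast (show 0 < M₀ by omega)
  by_cases h0 : nOp a c U k (Q i) x y = 0
  · rw [kLet_apply, h0, mul_zero, norm_zero, mul_zero]
  rw [kLet_apply, norm_mul, ← Complex.ofReal_sub, Complex.norm_real, Real.norm_eq_abs]
  refine mul_le_mul_of_nonneg_right ?_ (norm_nonneg _)
  have hhR : (0 : ℝ) < half P k M₀ := by exact_mod_cast hC.pos_half
  have ht := tdist_le_of_nOp_ne_zero hk a c U (Q i) h0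
  have htR : (Balaban1983to89.Site.tdist x y : ℝ) ≤ (P.d : ℝ) * (P.L : ℝ) ^ k := by exact_mod_cast ht
  calc |hT k M₀ i x - hT k M₀ i y| ≤ 3 * D1 hprof * (Balaban1983to89.Site.tdist x y : ℝ) / half P k M₀ := abs_hT_sub_le hC i x y
    _ ≤ 3 * D1 hprof * ((P.d : ℝ) * (P.L : ℝ) ^ k) / half P k M₀ := by gcongr
    _ = 3 * P.d * D1 hprof / M₀ := by
        unfold half; push_cast
        have hL : (0 : ℝ) < (P.L : ℝ) ^ k := pow_pos P.cast_L_pos k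
        field_simp

open scoped Matrix.Norms.Operator NNReal in
/-- entrywise domination passes to the `ℓ^∞`-operator norm: `‖A(x,y)‖ ≤ c‖B(x,y)‖` for all entries ⇒ `‖A‖ ≤ c‖B‖`. [folklore] -/
private theorem linfty_opNorm_le_of_entry_le {m n : Type*} [Fintype m] [Fintype n] {A B : Matrix m n ℂ} {cst : ℝ} (hc : 0 ≤ cst)
    (h : ∀ x y, ‖A x y‖ ≤ cst * ‖B x y‖) : ‖A‖ ≤ cst * ‖B‖ := by
  have hb0 : (0 : ℝ) ≤ cst * ‖B‖ := mul_nonneg hc (norm_nonneg _)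
  have rowB : ∀ x, (∑ y, ‖B x y‖ : ℝ) ≤ ‖B‖ := by
    intro x
    rw [linfty_opNorm_def]
    have h1 : (∑ y, ‖B x y‖₊) ≤ (Finset.univ : Finset m).sup fun i : m => ∑ j : n, ‖B i j‖₊ :=
      Finset.le_sup (f := fun i : m => ∑ j : n, ‖B i j‖₊) (Finset.mem_univ x)
    have h2 := NNReal.coe_le_coe.2 h1
    push_cast at h2
    exact h2
  have key : ∀ x, (∑ y, ‖A x y‖ : ℝ) ≤ cst * ‖B‖ := fun x =>
    calc (∑ y, ‖A x y‖ : ℝ) ≤ ∑ y, cst * ‖B x y‖ := Finset.sum_le_sum fun y _ => h x y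
      _ = cst * ∑ y, ‖B x y‖ := by rw [Finset.mul_sum]
      _ ≤ cst * ‖B‖ := mul_le_mul_of_nonneg_left (rowB x) hc
  rw [linfty_opNorm_def, ← Real.coe_toNNReal (cst * ‖B‖) hb0]
  refine NNReal.coe_le_coe.2 (Finset.sup_le fun x _ => ?_)
  rw [← NNReal.coe_le_coe, Real.coe_toNNReal _ hb0]
  push_cast
  exact key x

open scoped Matrix.Norms.Operator in
/-- **`‖K_i‖ ≤ (3d·sup|h′|/M₀)·‖H_{Q_i}(u)‖`** in the `ℓ^∞`-operator norm, for every family of regions, every `U(1)` field — the commutator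
is small, relative to the Neumann operator, by exactly the printed mechanism `|∂^ηh_j| ≤ O(M^{−1})`.  (The printed letter bound
`‖K_jG_k(□_j)h_j‖ ≤ c₂O(1)M^{−1}` needs in addition Lemma 2.1's `‖D G‖`-control; it stays a hypothesis, see §8.)
[cite: Balaban1983RegularityDecay, (2.12) p.577] -/
theorem norm_kLet_le (hC : CubeSize P j k M₀) (hk : j + k ≤ P.m + P.K) (a c : ℝ) (U : GaugeField P j U1)
    (Q : Lab P j k M₀ → Finset (Balaban1983to89.Site P j)) (i : Lab P j k M₀) :
    ‖kLet a c U k Q (hT k M₀) i‖ ≤ 3 * P.d * D1 hprof / M₀ * ‖nOp a c U k (Q i)‖ :=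
  linfty_opNorm_le_of_entry_le (by
      have hD : 0 ≤ D1 hprof := D1_nonneg contDiff_hprof hasCompactSupport_hprof
      positivity)
    (norm_kLet_apply_le hC hk a c U Q i)

/-- **THE SUPPORT OF `K_i`, ROWS**: `K_i(x, ·) = 0` unless `|x − Mi| ≤ ⅝M + L^k` coordinatewise — the rows of the commutator live in the
`L^k`-neighbourhood of `supp h_i`, i.e. deep inside `□_i`. [cite: Balaban1983RegularityDecay, (2.10) p.576] -/
theorem kLet_apply_eq_zero_of_not_near_left (hC : CubeSize P j k M₀) (hk : j + k ≤ P.m + P.K) (a c : ℝ) (U : GaugeField P j U1)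
    (Q : Lab P j k M₀ → Finset (Balaban1983to89.Site P j)) (i : Lab P j k M₀) {x : Balaban1983to89.Site P j}
    (hx : ¬ Near k M₀ (5 * half P k M₀ / 8 + P.L ^ k) i x) (y : Balaban1983to89.Site P j) : kLet a c U k Q (hT k M₀) i x y = 0 := by
  rw [kLet_apply]
  by_cases h0 : nOp a c U k (Q i) x y = 0
  · rw [h0, mul_zero]
  have hx0 : hT k M₀ i x = 0 := by
    by_contra hne; exact hx (near_mono (Nat.le_add_right _ _) (near_of_hT_ne_zero hC hne))
  have hy0 : hT k M₀ i y = 0 := by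
    by_contra hne
    have hc : ¬ ((∀ b : PBond P j, (y = b.src ∨ y = b.tgt) → ¬ (x = b.src ∨ x = b.tgt)) ∧ blkIter k y ≠ blkIter k x) := by
      intro hc
      refine h0 (nOp_apply_eq_zero_of_far a c U k (Q i) (fun b hxb hyb => hc.1 b hyb hxb) (fun e => hc.2 e.symm))
    exact hx (near_of_coupled hk (near_of_hT_ne_zero hC hne) (coupled_cases hc))
  rw [hx0, hy0, sub_self, zero_mul]

/-- **THE SUPPORT OF `K_i`, COLUMNS**: `K_i(·, y) = 0` unless `|y − Mi| ≤ ⅝M + L^k` coordinatewise. [cite: Balaban1983RegularityDecay, (2.10) p.576] -/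
theorem kLet_apply_eq_zero_of_not_near_right (hC : CubeSize P j k M₀) (hk : j + k ≤ P.m + P.K) (a c : ℝ) (U : GaugeField P j U1)
    (Q : Lab P j k M₀ → Finset (Balaban1983to89.Site P j)) (i : Lab P j k M₀) (x : Balaban1983to89.Site P j)
    {y : Balaban1983to89.Site P j} (hy : ¬ Near k M₀ (5 * half P k M₀ / 8 + P.L ^ k) i y) : kLet a c U k Q (hT k M₀) i x y = 0 := by
  rw [kLet_apply]
  by_cases h0 : nOp a c U k (Q i) x y = 0
  · rw [h0, mul_zero]
  have hy0 : hT k M₀ i y = 0 := by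
    by_contra hne; exact hy (near_mono (Nat.le_add_right _ _) (near_of_hT_ne_zero hC hne))
  have hx0 : hT k M₀ i x = 0 := by
    by_contra hne
    have hc : ¬ ((∀ b : PBond P j, (x = b.src ∨ x = b.tgt) → ¬ (y = b.src ∨ y = b.tgt)) ∧ blkIter k x ≠ blkIter k y) :=
      fun hc => h0 (nOp_apply_eq_zero_of_far a c U k (Q i) hc.1 hc.2)
    exact hy (near_of_coupled hk (near_of_hT_ne_zero hC hne) (coupled_cases hc))
  rw [hx0, hy0, sub_self, zero_mul]

/-- **THE SUPPORT OF `K_i`, THE PLATEAU**: `K_i(x, ·) = 0` for `|x − Mi| ≤ r` whenever `8(r + L^k) ≤ 3M` — inside the `⅜M`-core `h_i ≡ 1`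
at both ends of any coupled pair (*"h(x) = 1 for x ∈ [−⅓, ⅓]"*; so `K_i` lives in the annulus `⅜M − L^k < |· − Mi| ≤ ⅝M + L^k`).
[cite: Balaban1983RegularityDecay, (2.10) p.576] -/
theorem kLet_apply_eq_zero_of_near_core (hC : CubeSize P j k M₀) (hk : j + k ≤ P.m + P.K) (a c : ℝ) (U : GaugeField P j U1)
    (Q : Lab P j k M₀ → Finset (Balaban1983to89.Site P j)) (i : Lab P j k M₀) {r : ℕ} (hr : 8 * (r + P.L ^ k) ≤ 3 * half P k M₀)
    {x : Balaban1983to89.Site P j} (hx : Near k M₀ r i x) (y : Balaban1983to89.Site P j) : kLet a c U k Q (hT k M₀) i x y = 0 := by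
  rw [kLet_apply]
  by_cases h0 : nOp a c U k (Q i) x y = 0
  · rw [h0, mul_zero]
  have hc : ¬ ((∀ b : PBond P j, (x = b.src ∨ x = b.tgt) → ¬ (y = b.src ∨ y = b.tgt)) ∧ blkIter k x ≠ blkIter k y) :=
    fun hc => h0 (nOp_apply_eq_zero_of_far a c U k (Q i) hc.1 hc.2)
  have hyn := near_of_coupled hk hx (coupled_cases hc)
  rw [hT_eq_one_of_near hC (by omega) hx, hT_eq_one_of_near hC hr hyn, sub_self, zero_mul]

end Lipschitz

/-! ## §8 ASSEMBLY: (2.12)/(2.13) for `G_k(Ω,u)` with [6]'s OWN cubes — gen 25's theorems with every combinatorial input discharged -/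

section Assembly

open scoped Matrix.Norms.Operator

variable {k M₀ : ℕ}

/-- **`‖R‖ ≤ 2^d·β`** for [6]'s cubes on the torus: the remainder `R = Σ_i K_iG_k(Ω ∩ □_i,u)h_i` is as small as the single letters,
UNIFORMLY IN THE VOLUME (gen 25's `norm_rOp_le` with the multiplicity `2^d` of §3 and `|h_i| ≤ 1` of §4 discharged), given the letter
bound `‖K_iG_k(Ω ∩ □_i,u)‖ ≤ β` (the print's `c₂O(1)M^{−1}`). [cite: Balaban1983RegularityDecay, (2.12) p.577] -/
theorem norm_rOp_cubes_le (hC : CubeSize P j k M₀) (a c : ℝ) (U : GaugeField P j U1) (Ω : Finset (Balaban1983to89.Site P j)) {β : ℝ}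
    (hβ0 : 0 ≤ β) (hβ : ∀ i : Lab P j k M₀, ‖kLet a c U k (fun i => Ω ∩ cube k M₀ i) (hT k M₀) i * gBox a c U k (Ω ∩ cube k M₀ i)‖ ≤ β) :
    ‖rOp a c U k (fun i : Lab P j k M₀ => Ω ∩ cube k M₀ i) (hT k M₀)‖ ≤ (2 ^ P.d : ℕ) * β :=
  norm_rOp_le U (card_filter_mem_inter_cube_le hC Ω) hβ0 fun i => (norm_bLet_le U (abs_hT_le_one hC i)).trans (hβ i)

/-- **(2.12) `G_k(Ω,u) = Σ_n G₀Rⁿ` FOR [6]'S CUBES ON THE TORUS**, given only the letter bound `‖K_iG_k(Ω ∩ □_i,u)‖ ≤ β` with `2^dβ < 1`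
(every `U(1)` field `u`, every `k`-block union `Ω`; standing range). [cite: Balaban1983RegularityDecay, (2.12) p.577] -/
theorem hasSum_gZero_mul_pow_cubes (hC : CubeSize P j k M₀) (hk : j + k ≤ P.m + P.K) {a c : ℝ} (hc : c ≠ 0) (ha : 0 < a)
    (U : GaugeField P j U1) {Ω : Finset (Balaban1983to89.Site P j)} (hΩ : IsBlockUnion k Ω) {β : ℝ} (hβ0 : 0 ≤ β)
    (hβ : ∀ i : Lab P j k M₀, ‖kLet a c U k (fun i => Ω ∩ cube k M₀ i) (hT k M₀) i * gBox a c U k (Ω ∩ cube k M₀ i)‖ ≤ β)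
    (hmβ : ((2 ^ P.d : ℕ) : ℝ) * β < 1) :
    HasSum (fun n : ℕ => gZero a c U k (fun i : Lab P j k M₀ => Ω ∩ cube k M₀ i) (hT k M₀)
        * rOp a c U k (fun i : Lab P j k M₀ => Ω ∩ cube k M₀ i) (hT k M₀) ^ n) (gBox a c U k Ω) :=
  hasSum_gZero_mul_pow (isLocalization_cubes hC hk hΩ) hk hc ha U hΩ ((norm_rOp_cubes_le hC a c U Ω hβ0 hβ).trans_lt hmβ)

/-- **(2.13) THE RANDOM WALK REPRESENTATION OF `G_k(Ω,u)` WITH [6]'S OWN `M`-CUBE PARTITION ON THE TORUS**: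
`G_k(Ω,u) = Σ_ω h_{ω₀}G_k(Ω∩□_{ω₀},u)h_{ω₀}K_{ω₁}G_k(Ω∩□_{ω₁},u)h_{ω₁}⋯` as an unconditional sum over all walks, for EVERY `U(1)` field `u`
and every `k`-block union `Ω ⊆ T^{(j)}` — gen 25's `hasSum_piece_of_inputs` with the localization datum (§5), `|h_i| ≤ 1` (§4), the
multiplicity `m₀ = 2^d` (§3), the adjacency of degree `D = 3^d` and the «obvious fact» (§6) ALL DISCHARGED by the construction; what remains
are exactly the two printed analytic inputs of p. 577: `‖G_k(Ω∩□_i,u)‖ ≤ α` (Lemma 2.1) and `‖K_iG_k(Ω∩□_i,u)‖ ≤ β` (*"≤ c₂O(1)M^{−1}"*) with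
`3^dβ < 1`, `2^dβ < 1` (*"M fixed with 3^dc₂O(1)M^{−1} ≤ e^{−1}"*, (2.22)). [cite: Balaban1983RegularityDecay, (2.13) p.577] -/
theorem hasSum_piece_cubes (hC : CubeSize P j k M₀) (hk : j + k ≤ P.m + P.K) {a c : ℝ} (hc : c ≠ 0) (ha : 0 < a)
    (U : GaugeField P j U1) {Ω : Finset (Balaban1983to89.Site P j)} (hΩ : IsBlockUnion k Ω) {α β : ℝ}
    (hα : ∀ i : Lab P j k M₀, ‖gBox a c U k (Ω ∩ cube k M₀ i)‖ ≤ α) (hβ0 : 0 ≤ β)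
    (hβ : ∀ i : Lab P j k M₀, ‖kLet a c U k (fun i => Ω ∩ cube k M₀ i) (hT k M₀) i * gBox a c U k (Ω ∩ cube k M₀ i)‖ ≤ β)
    (hDβ : ((3 ^ P.d : ℕ) : ℝ) * β < 1) (hmβ : ((2 ^ P.d : ℕ) : ℝ) * β < 1) :
    HasSum (piece a c U k (fun i : Lab P j k M₀ => Ω ∩ cube k M₀ i) (hT k M₀)) (gBox a c U k Ω) :=
  hasSum_piece_of_inputs (isLocalization_cubes hC hk hΩ) hk hc ha U hΩ (fun i => abs_hT_le_one hC i) LabAdj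
    (fun _ _ hil => (letters_mul_eq_zero_of_not_labAdj hC hk a c U _ hil).1)
    (fun _ _ hil => (letters_mul_eq_zero_of_not_labAdj hC hk a c U _ hil).2)
    (card_filter_labAdj_le hC) (card_filter_mem_inter_cube_le hC Ω) hα hβ0 hβ hDβ hmβ

end Assembly

end

end Literature.MathematicalPhysics.QuantumFieldTheory.BalabanImbrieJaffe1984to88.BIJ88NeumannCubePartitionTorus
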